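import Literature.Barriers.RiemannHypothesis.MollifierLimitationsPropAProofs
import Literature.Barriers.RiemannHypothesis.MollifierLimitationsSelberg
import Literature.Barriers.RiemannHypothesis.BettinGonek2017LowerBoundProofs
import Literature.NumberTheory.LFunctions.ZetaEulerProductMeanSquare
import Literature.NumberTheory.Sieve.AsymptoticSieveForPrimesRoughMoebius
import Literature.NumberTheory.Sieve.BombieriAsymptoticSieveSmoothPart
import Mathlib.NumberTheory.Harmonic.Bounds
import HarnessLib

/-!
# Radziwiłł 2012, Theorem 1: the short-mollifier range unconditionally, and Theorem 1 from
# Proposition A and Lemma 5 alone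

Sibling of `Literature/Barriers/RiemannHypothesis/MollifierLimitations.lean`, which vendors
**Theorem 1** of M. Radziwiłł, *Limitations to mollifying `ζ(s)`* (arXiv:1207.6583) as the named
fact `Radziwill2012_thm1` — `𝓘(M_θ) = T⁻¹ ∫_T^{2T} |1 − ζ(½+it) M_θ(½+it)|² dt ≥ c/θ` for an
absolute `c > 0`, every `θ > 0`, all large `T` and every mollifier `M_θ(s) = Σ_{n ≤ T^θ} a(n) n^{-s}`
with `a(1) = 1`, `a(n) ≪ n^ε` — one half of the catalogued barrier `MollifierLimitations`.

The printed proof (§4) splits at `θ = ½`: for `θ ≥ ½` Proposition A with Selberg's well-spaced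
critical zeros (Lemma 5), for `θ < ½` Proposition B (the Balasubramanian–Conrey–Heath-Brown
asymptotic for the twisted second moment together with Soundararajan's lower bound for the
resulting quadratic form, §7). The tree proves all these deductions
(`Radziwill2012_thm1_of_inputs`, `Radziwill2012_floor_of_propA_lemma5`,
`Radziwill2012_propA_of_lemma2`, `Radziwill2012_lemma5_of_selbergLemma`,
`Radziwill2012_propB_of_parts`), leaving four named facts
(`MollifierLimitationsStatus.lean`): Selberg's lemma, the Bombieri–Friedlander smoothed
approximate functional equation (Lemma 2), and the two relations of Proposition B.

This file removes Proposition B from that list. Everything here is PROVED (no named facts):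

* `SmallTheta.Radziwill2012_thm1_smallTheta` — **the range `0 < θ ≤ θ₁` of Theorem 1,
  unconditionally**, with the absolute constants `θ₁ = 1/(16e⁵)`, `c₁ = 1/(192e⁵)`: for
  `0 < θ ≤ θ₁`, every family of implied constants `C`, all `T ≥ T₀(θ, C)` and all admissible `a`,
  `𝓘(M_θ) ≥ c₁/θ`.
* `Radziwill2012_thm1_of_propA_lemma5` — **Theorem 1 from Proposition A and Lemma 5 only**
  (the floor `c/(1+θ)` for all `θ` from `Radziwill2012_floor_of_propA_lemma5`, and the theorem above
  for `θ ≤ θ₁`; `1 + θ ≤ θ(1 + 1/θ₁)` for `θ ≥ θ₁`).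
* `Radziwill2012_thm1_of_selberg_of_lemma2`, `MollifierLimitations_of_propA_lemma5`,
  `MollifierLimitations_of_selberg_of_lemma2` — hence `Radziwill2012_thm1`, and the whole barrier
  `MollifierLimitations` (its Bettin–Gonek half being the theorem `BettinGonek2017_thm1_holds`),
  follow from exactly two named facts: `Radziwill2012_selbergLemma` (Selberg 1942, positive
  proportion of critical zeros in the dyadic measure form) and `Radziwill2012_lemma2`
  (Bombieri–Friedlander 1995, Prop. 2).

## The argument for short mollifiers (not the printed one)

Radziwiłł recalls in §1 (p. 3) the "trivial" lower bound `∫_T^{2T} |F(½+it)|² dt ≫ T Σ_{n ≤ T} |a(n)|²/n`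
for the mean square of a Dirichlet series in terms of its first `T` coefficients, and remarks that
for `F = 1 − ζ𝓛_θ` it is of size `≍ T/(1+θ)²` — of the right order `T/θ` exactly when `θ` is small.
We make this quantitative by duality, for an arbitrary admissible `M = M_θ` of length `N = ⌊T^θ⌋`.
Let `Y = ⌊T^{1/4}⌋`, let `𝒩` be the set of `2 ≤ m ≤ Y` all of whose prime factors exceed `N`
(`SmallTheta.siftedSet`), `S = Σ_{m ∈ 𝒩} 1/m`, and test `F = 1 − ζM` against
`G(s) = Σ_{m ∈ 𝒩} m^{-s}` on the critical line:

1. *Twisted first moment.* By Euler–Maclaurin (the tree's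
   `EulerProductMeanSquare.norm_zeta_sub_sum_sub_le` with `a = 3/2`, `ν = 1`; Titchmarsh §4.11),
   `ζ(½+it) = Σ_{n < L} n^{-½-it} + O(T^{-1/4})` on `[T, 2T]` with `L = ⌈(2T)^{3/2}⌉` (the polar
   term `L^{½-it}/(it − ½)` is `O(T^{-1/4})` there). Multiplying out,
   `∫_T^{2T} (Σ_n n^{-½-it}) M(½+it) conj G(½+it) dt = Σ_{n,d,m} a(d)(ndm)^{-½} ∫_T^{2T} (m/nd)^{it} dt`;
   the diagonal `nd = m` forces `d = 1` (a divisor `d ≤ N` of a sifted `m` is `1`), `n = m`, and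
   contributes `a(1) T Σ_{m ∈ 𝒩} 1/m = T·S`; off the diagonal `|∫_T^{2T} e^{-iνt} dt| ≤ 2/|ν|` with
   `|ν| = |log(nd/m)| ≥ 1/(2m)`, and `≥ log 2` once `n ≥ 2m`, which bounds the rest by
   `A₀ (8√2 Y² + 16 √L √Y)`, `A₀ = Σ_{d ≤ N} |a(d)|`. With `|∫_T^{2T} conj G| ≤ 8√Y` this gives
   `|∫_T^{2T} F conj G dt| ≥ T S − O_C(T^{31/32})` (`SmallTheta.integral_norm_sq_ge_of_errors`,
   `SmallTheta.error_budget`).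
2. *Mean square of `G`.* `∫_T^{2T} |G|² ≤ (5T/2 + 65Y) S ≤ 3 T S` by the mean value theorem for
   Dirichlet polynomials (the tree's `DirichletMVT.meanSquare_shift_le_sharp`).
3. *Cauchy–Schwarz* (in the form `|∫ F Ḡ| ≤ 3∫|F|² + (1/12)∫|G|²`): `∫_T^{2T} |F|² ≥ T S/12`.
4. *Sieve.* Factoring each `n ≤ Y` into its `N`-rough and `N`-smooth parts,
   `Σ_{n ≤ Y} 1/n ≤ (1 + S) ∏_{p ≤ N} (1 − 1/p)⁻¹ ≤ (1 + S) e⁵ log(N+1)` (Euler product over smooth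
   numbers and the tree's elementary Mertens bound, `MoebiusRough.sum_rpow_neg_le_prod_of_smooth`,
   `MoebiusRough.prod_primesBelow_one_sub_inv_inv_le`), so `1 + S ≥ (¼ log T)/(2e⁵ θ log T)` and
   `S ≥ 1/(16 e⁵ θ)` for `θ ≤ 1/(16e⁵)`; hence `𝓘(M_θ) ≥ S/12 ≥ 1/(192 e⁵ θ)`.

The constants are poor (`θ₁ ≈ 4.2·10⁻⁴`, `c₁ ≈ 3.5·10⁻⁵`; Proposition B gives `c = 1` on
`θ < ½`), but Theorem 1 asserts only the existence of an absolute `c > 0`, and the vendored `Prop`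
`Radziwill2012_thm1` is proved from Proposition A and Lemma 5 exactly as stated, with
`c = min c₁ (c_A θ₁/(1 + θ₁))`.

## References

* [Radziwill2012] M. Radziwiłł, *Limitations to mollifying ζ(s)*, arXiv:1207.6583 (2012): Thm. 1
  (p. 3), the "trivial lower bound" paragraph of §1 (p. 3), §4 (deduction of Thm. 1, p. 8).
* [Titchmarsh1986] E. C. Titchmarsh, *The Theory of the Riemann Zeta-Function*, 2nd ed. (1986),
  §4.11 (the simplest approximation to `ζ`), §7.2 (mean values of Dirichlet polynomials).
* [HardyWright2008] G. H. Hardy, E. M. Wright, *An Introduction to the Theory of Numbers*, 6th ed.,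
  Thm. 429 (Mertens' product).
-/

noncomputable section

open Complex MeasureTheory Real Set Finset

namespace Literature.Barriers.RiemannHypothesis

namespace SmallTheta

/-! ## §1 Elementary lemmas -/

/-- `∫_a^b e^{-iνt} dt = b - a` for `ν = 0`. [folklore] -/
theorem integral_linePhase_zero (a b : ℝ) :
    ∫ t in a..b, linePhase 0 t = ((b - a : ℝ) : ℂ) := by
  simp [linePhase_zero]

/-- `‖∫_a^b e^{-iνt} dt‖ ≤ 2/|ν|` for `ν ≠ 0`. [folklore] -/
theorem norm_integral_linePhase_le {ν : ℝ} (hν : ν ≠ 0) (a b : ℝ) :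
    ‖∫ t in a..b, linePhase ν t‖ ≤ 2 / |ν| := by
  have hc : (-(ν : ℂ) * I) ≠ 0 := by
    apply mul_ne_zero _ I_ne_zero
    exact neg_ne_zero.2 (by exact_mod_cast hν)
  have hfun : (fun t : ℝ ↦ linePhase ν t) = fun t : ℝ ↦ cexp (-(ν : ℂ) * I * (t : ℂ)) := by
    funext t
    unfold linePhase
    congr 1
    push_cast
    ring
  rw [hfun, integral_exp_mul_complex hc]
  have hnc : ‖-(ν : ℂ) * I‖ = |ν| := by
    rw [norm_mul, norm_neg, Complex.norm_real, Complex.norm_I, mul_one, Real.norm_eq_abs]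
  have h1 : ∀ x : ℝ, ‖cexp (-(ν : ℂ) * I * (x : ℂ))‖ = 1 := by
    intro x
    rw [show -(ν : ℂ) * I * (x : ℂ) = ((-(ν * x) : ℝ) : ℂ) * I by push_cast; ring]
    exact Complex.norm_exp_ofReal_mul_I _
  rw [norm_div, hnc]
  gcongr
  calc ‖cexp (-(ν : ℂ) * I * (b : ℂ)) - cexp (-(ν : ℂ) * I * (a : ℂ))‖
      ≤ ‖cexp (-(ν : ℂ) * I * (b : ℂ))‖ + ‖cexp (-(ν : ℂ) * I * (a : ℂ))‖ := norm_sub_le _ _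
    _ = 2 := by rw [h1, h1]; norm_num

/-- For distinct positive integers `q ≠ m`: `|log q - log m| ≥ 1/(2m)`. [folklore] -/
theorem inv_two_mul_le_abs_log_sub {q m : ℕ} (hq : 1 ≤ q) (hm : 1 ≤ m) (hqm : q ≠ m) :
    1 / (2 * (m : ℝ)) ≤ |Real.log q - Real.log m| := by
  have hq0 : (0 : ℝ) < q := by exact_mod_cast hq
  have hm0 : (0 : ℝ) < m := by exact_mod_cast hm
  have hm1 : (1 : ℝ) ≤ m := by exact_mod_cast hm
  rcases lt_or_gt_of_ne hqm with h | h
  · -- `q < m`: `log m - log q ≥ 1 - q/m = (m - q)/m ≥ 1/m`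
    have hle : (q : ℝ) + 1 ≤ m := by exact_mod_cast h
    have h2 : 1 - ((m : ℝ) / q)⁻¹ ≤ Real.log ((m : ℝ) / q) :=
      Real.one_sub_inv_le_log_of_pos (by positivity)
    rw [inv_div, Real.log_div hm0.ne' hq0.ne'] at h2
    have h3 : 1 / (2 * (m : ℝ)) ≤ 1 - (q : ℝ) / m := by
      rw [show 1 - (q : ℝ) / m = (m - q) / m by field_simp,
        div_le_div_iff₀ (by positivity) hm0]
      nlinarith
    have h4 : 0 < 1 / (2 * (m : ℝ)) := by positivity
    rw [abs_sub_comm, abs_of_nonneg (by linarith)]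
    linarith
  · -- `q > m`: `log q - log m ≥ 1 - m/q = (q - m)/q ≥ 1/(2m)`
    have hle : (m : ℝ) + 1 ≤ q := by exact_mod_cast h
    have h2 : 1 - ((q : ℝ) / m)⁻¹ ≤ Real.log ((q : ℝ) / m) :=
      Real.one_sub_inv_le_log_of_pos (by positivity)
    rw [inv_div, Real.log_div hq0.ne' hm0.ne'] at h2
    have h3 : 1 / (2 * (m : ℝ)) ≤ 1 - (m : ℝ) / q := by
      rw [show 1 - (m : ℝ) / q = (q - m) / q by field_simp,
        div_le_div_iff₀ (by positivity) hq0]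
      nlinarith [mul_le_mul_of_nonneg_right hle (by linarith : (0 : ℝ) ≤ 2 * m - 1)]
    have h4 : 0 < 1 / (2 * (m : ℝ)) := by positivity
    rw [abs_of_nonneg (by linarith)]
    linarith

/-- For positive integers with `q ≥ 2m`: `log q - log m ≥ log 2`. [folklore] -/
theorem log_two_le_log_sub {q m : ℕ} (hm : 1 ≤ m) (hqm : 2 * m ≤ q) :
    Real.log 2 ≤ Real.log q - Real.log m := by
  have hm0 : (0 : ℝ) < m := by exact_mod_cast hm
  have hle : 2 * (m : ℝ) ≤ q := by exact_mod_cast hqm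
  have : Real.log (2 * m) ≤ Real.log q := Real.log_le_log (by positivity) hle
  rw [Real.log_mul (by norm_num) hm0.ne'] at this
  linarith

/-- `1/2 ≤ log 2`. [folklore] -/
theorem half_le_log_two : (1 / 2 : ℝ) ≤ Real.log 2 := by
  have := Real.log_two_gt_d9; linarith

/-! ## §2 The sifted set and the sieve lower bound -/

/-- The sifted set `𝒩 = {2 ≤ m ≤ Y : every prime factor of m exceeds N}` (the integers up to `Y`
all of whose prime factors are `> N`). [folklore] -/
def siftedSet (N Y : ℕ) : Finset ℕ :=
  (Finset.Icc 2 Y).filter fun m ↦ ∀ p ∈ m.primeFactors, N < p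

/-- Membership in the sifted set. [folklore] -/
theorem mem_siftedSet {N Y m : ℕ} :
    m ∈ siftedSet N Y ↔ (2 ≤ m ∧ m ≤ Y) ∧ ∀ p ∈ m.primeFactors, N < p := by
  simp [siftedSet]

/-- Sifted numbers are `≥ 2`. [folklore] -/
theorem two_le_of_mem_siftedSet {N Y m : ℕ} (h : m ∈ siftedSet N Y) : 2 ≤ m :=
  (mem_siftedSet.1 h).1.1

/-- Sifted numbers are `≤ Y`. [folklore] -/
theorem le_of_mem_siftedSet {N Y m : ℕ} (h : m ∈ siftedSet N Y) : m ≤ Y :=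
  (mem_siftedSet.1 h).1.2

/-- `1` is not in the sifted set (by convention `m ≥ 2`). [folklore] -/
theorem one_not_mem_siftedSet (N Y : ℕ) : 1 ∉ siftedSet N Y := fun h ↦ by
  have := two_le_of_mem_siftedSet h; omega

/-- The sifted set lies in `[1, Y]`. [folklore] -/
theorem siftedSet_subset_Icc (N Y : ℕ) : siftedSet N Y ⊆ Finset.Icc 1 Y := fun m hm ↦ by
  rw [Finset.mem_Icc]; exact ⟨by have := two_le_of_mem_siftedSet hm; omega, le_of_mem_siftedSet hm⟩

/-- The key divisibility property: a divisor `d ≤ N` of a sifted number is `1`. [folklore] -/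
theorem eq_one_of_dvd_of_mem_siftedSet {N Y m d : ℕ} (hm : m ∈ siftedSet N Y) (hd : d ≤ N)
    (hdm : d ∣ m) : d = 1 := by
  by_contra hd1
  have hm2 := two_le_of_mem_siftedSet hm
  have hd0 : d ≠ 0 := by rintro rfl; rw [zero_dvd_iff] at hdm; omega
  have hp : d.minFac.Prime := Nat.minFac_prime hd1
  have hpm : d.minFac ∈ m.primeFactors :=
    Nat.mem_primeFactors.2 ⟨hp, (Nat.minFac_dvd d).trans hdm, by omega⟩
  have h1 := (mem_siftedSet.1 hm).2 _ hpm
  have h2 : d.minFac ≤ d := Nat.minFac_le (Nat.pos_of_ne_zero hd0)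
  omega

/-- The `N`-rough part of `n`: the cofactor `n / ∏_{p | n, p ≤ N} p^{v_p(n)}` of the tree's
`(N+1)`-smooth part `Literature.NumberTheory.Sieve.smoothPart (N + 1) n`. [folklore] -/
def roughPart (N n : ℕ) : ℕ := n / Literature.NumberTheory.Sieve.smoothPart (N + 1) n

/-- The Legendre factorisation `n = (rough part) · (smooth part)` (`n ≠ 0`). [folklore] -/
theorem roughPart_mul_smoothPart {N n : ℕ} (hn : n ≠ 0) :
    roughPart N n * Literature.NumberTheory.Sieve.smoothPart (N + 1) n = n := by
  rw [roughPart, mul_comm]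
  exact Literature.NumberTheory.Sieve.smoothPart_mul_div hn (N + 1)

/-- The rough part of `n ≠ 0` is nonzero. [folklore] -/
theorem roughPart_ne_zero {N n : ℕ} (hn : n ≠ 0) : roughPart N n ≠ 0 :=
  (Nat.div_ne_zero_iff_of_dvd (Literature.NumberTheory.Sieve.smoothPart_dvd hn (N + 1))).2
    ⟨hn, Literature.NumberTheory.Sieve.smoothPart_ne_zero (N + 1) n⟩

/-- All prime factors of the rough part of `n ≠ 0` exceed `N`. [folklore] -/
theorem lt_of_mem_primeFactors_roughPart {N n p : ℕ} (hn : n ≠ 0)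
    (hp : p ∈ (roughPart N n).primeFactors) : N < p := by
  by_contra hle
  exact Literature.NumberTheory.Sieve.not_dvd_div_smoothPart (Nat.prime_of_mem_primeFactors hp)
    (show p < N + 1 by omega) hn (Nat.dvd_of_mem_primeFactors hp)

/-- The rough part divides `n`. [folklore] -/
theorem roughPart_dvd {N n : ℕ} (hn : n ≠ 0) : roughPart N n ∣ n :=
  Nat.div_dvd_of_dvd (Literature.NumberTheory.Sieve.smoothPart_dvd hn (N + 1))

/-- The rough part of `1 ≤ n ≤ Y` is `1` or lies in the sifted set. [folklore] -/
theorem roughPart_mem_insert {N Y n : ℕ} (hn : n ∈ Finset.Icc 1 Y) :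
    roughPart N n ∈ insert 1 (siftedSet N Y) := by
  rw [Finset.mem_Icc] at hn
  have hn0 : n ≠ 0 := by omega
  rw [Finset.mem_insert]
  by_cases h1 : roughPart N n = 1
  · exact Or.inl h1
  · refine Or.inr (mem_siftedSet.2 ⟨⟨?_, ?_⟩, fun p hp ↦ lt_of_mem_primeFactors_roughPart hn0 hp⟩)
    · have := roughPart_ne_zero (N := N) hn0; omega
    · exact (Nat.le_of_dvd (by omega) (roughPart_dvd (N := N) hn0)).trans hn.2

/-- **The sieve lower bound (Legendre / Rankin form).** Every `1 ≤ n ≤ Y` factors as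
(rough part) × (smooth part), whence
`∑_{n ≤ Y} 1/n ≤ (1 + ∑_{m ∈ 𝒩} 1/m) · ∏_{p ≤ N} (1 - 1/p)⁻¹`. [folklore] -/
theorem harmonic_le_siftedSum_mul_prod (N Y : ℕ) :
    ∑ n ∈ Finset.Icc 1 Y, 1 / (n : ℝ) ≤
      (1 + ∑ m ∈ siftedSet N Y, 1 / (m : ℝ)) *
        ∏ p ∈ (N + 1).primesBelow, (1 - (p : ℝ)⁻¹)⁻¹ := by
  classical
  set R : Finset ℕ := insert 1 (siftedSet N Y) with hR
  set K : Finset ℕ := (Finset.Icc 1 Y).image (Literature.NumberTheory.Sieve.smoothPart (N + 1)) with hK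
  set g : ℕ → ℕ × ℕ := fun n ↦ (roughPart N n, Literature.NumberTheory.Sieve.smoothPart (N + 1) n)
    with hg
  set f : ℕ × ℕ → ℝ := fun x ↦ 1 / (x.1 : ℝ) * (1 / (x.2 : ℝ)) with hf
  have hf0 : ∀ x, 0 ≤ f x := fun x ↦ by simp only [hf]; positivity
  -- `1/n = f (g n)`
  have h1 : ∀ n ∈ Finset.Icc 1 Y, 1 / (n : ℝ) = f (g n) := by
    intro n hn
    rw [Finset.mem_Icc] at hn
    simp only [hf, hg]
    rw [one_div_mul_one_div, ← Nat.cast_mul, roughPart_mul_smoothPart (by omega)]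
  -- `g` is injective on `[1, Y]`
  have hinj : Set.InjOn g (Finset.Icc 1 Y : Set ℕ) := by
    intro n hn n' hn' h
    simp only [hg, Prod.mk.injEq] at h
    have hn0 : n ≠ 0 := by rw [Finset.coe_Icc, Set.mem_Icc] at hn; omega
    have hn0' : n' ≠ 0 := by rw [Finset.coe_Icc, Set.mem_Icc] at hn'; omega
    rw [← roughPart_mul_smoothPart (N := N) hn0, ← roughPart_mul_smoothPart (N := N) hn0', h.1, h.2]
  -- the image lies in `R × K`
  have himg : (Finset.Icc 1 Y).image g ⊆ R ×ˢ K := by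
    intro x hx
    rw [Finset.mem_image] at hx
    obtain ⟨n, hn, rfl⟩ := hx
    rw [Finset.mem_product]
    exact ⟨roughPart_mem_insert hn, Finset.mem_image_of_mem _ hn⟩
  calc ∑ n ∈ Finset.Icc 1 Y, 1 / (n : ℝ) = ∑ n ∈ Finset.Icc 1 Y, f (g n) :=
        Finset.sum_congr rfl h1
    _ = ∑ x ∈ (Finset.Icc 1 Y).image g, f x := (Finset.sum_image hinj).symm
    _ ≤ ∑ x ∈ R ×ˢ K, f x := Finset.sum_le_sum_of_subset_of_nonneg himg fun x _ _ ↦ hf0 x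
    _ = (∑ m ∈ R, 1 / (m : ℝ)) * ∑ k ∈ K, 1 / (k : ℝ) := by
        rw [Finset.sum_product, Finset.sum_mul_sum]
    _ ≤ (∑ m ∈ R, 1 / (m : ℝ)) * ∏ p ∈ (N + 1).primesBelow, (1 - (p : ℝ)⁻¹)⁻¹ := by
        refine mul_le_mul_of_nonneg_left ?_ (Finset.sum_nonneg fun m _ ↦ by positivity)
        · have hKs : ∀ b ∈ K, b ∈ (N + 1).smoothNumbers := by
            intro b hb
            rw [hK, Finset.mem_image] at hb
            obtain ⟨n, -, rfl⟩ := hb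
            exact Literature.NumberTheory.Sieve.smoothPart_mem_smoothNumbers (N + 1) n
          have h := Literature.NumberTheory.Sieve.MoebiusRough.sum_rpow_neg_le_prod_of_smooth
            one_pos (N + 1) K hKs
          have hl : ∑ b ∈ K, (b : ℝ) ^ (-(1 : ℝ)) = ∑ k ∈ K, 1 / (k : ℝ) :=
            Finset.sum_congr rfl fun b _ ↦ by rw [Real.rpow_neg_one, one_div]
          have hr : ∏ p ∈ (N + 1).primesBelow, (1 - (p : ℝ) ^ (-(1 : ℝ)))⁻¹ =
              ∏ p ∈ (N + 1).primesBelow, (1 - (p : ℝ)⁻¹)⁻¹ :=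
            Finset.prod_congr rfl fun p _ ↦ by rw [Real.rpow_neg_one]
          rwa [hl, hr] at h
    _ = (1 + ∑ m ∈ siftedSet N Y, 1 / (m : ℝ)) *
          ∏ p ∈ (N + 1).primesBelow, (1 - (p : ℝ)⁻¹)⁻¹ := by
        rw [hR, Finset.sum_insert (one_not_mem_siftedSet N Y)]
        simp

/-- **The sifted harmonic sum is large**: for `N ≥ 2`,
`log (Y + 1) ≤ (1 + ∑_{m ∈ 𝒩} 1/m) · e⁵ · log (N + 1)`. [folklore] -/
theorem log_le_siftedSum_mul (N Y : ℕ) (hN : 2 ≤ N) :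
    Real.log (Y + 1) ≤ (1 + ∑ m ∈ siftedSet N Y, 1 / (m : ℝ)) * (Real.exp 5 * Real.log (N + 1)) := by
  have h1 : Real.log (Y + 1) ≤ ∑ n ∈ Finset.Icc 1 Y, 1 / (n : ℝ) := by
    have h := log_add_one_le_harmonic Y
    rw [harmonic_eq_sum_Icc] at h
    push_cast at h
    simpa [one_div] using h
  have h2 := harmonic_le_siftedSum_mul_prod N Y
  have h3 := Literature.NumberTheory.Sieve.MoebiusRough.prod_primesBelow_one_sub_inv_inv_le
    (N := N + 1) (by omega)
  have hpos : 0 ≤ 1 + ∑ m ∈ siftedSet N Y, 1 / (m : ℝ) :=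
    add_nonneg zero_le_one (Finset.sum_nonneg fun m _ ↦ by positivity)
  push_cast at h3
  calc Real.log (Y + 1) ≤ ∑ n ∈ Finset.Icc 1 Y, 1 / (n : ℝ) := h1
    _ ≤ _ := h2
    _ ≤ _ := mul_le_mul_of_nonneg_left h3 hpos

/-! ## §3 The test polynomial and its mean square -/

/-- `‖n^{-½}‖ = n^{-½}`. [folklore] -/
theorem norm_halfPow (n : ℕ) : ‖halfPow n‖ = (n : ℝ) ^ (-(1 / 2 : ℝ)) := by
  unfold halfPow
  rw [Complex.norm_real, Real.norm_eq_abs, abs_of_nonneg (Real.rpow_nonneg (Nat.cast_nonneg n) _)]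

/-- `‖n^{-½}‖² = 1/n` for `n ≥ 1`. [folklore] -/
theorem norm_halfPow_sq {n : ℕ} (hn : n ≠ 0) : ‖halfPow n‖ ^ 2 = 1 / (n : ℝ) := by
  have hn0 : (0 : ℝ) < n := by exact_mod_cast Nat.pos_of_ne_zero hn
  rw [norm_halfPow, ← Real.rpow_natCast, ← Real.rpow_mul hn0.le]
  norm_num
  rw [Real.rpow_neg_one]

/-- `halfPow 1 = 1`. [folklore] -/
theorem halfPow_one : halfPow 1 = 1 := by
  simp [halfPow]

/-- `halfPow m * halfPow m = 1/m` for `m ≥ 1`. [folklore] -/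
theorem halfPow_mul_self {m : ℕ} (hm : m ≠ 0) : halfPow m * halfPow m = (1 / (m : ℝ) : ℝ) := by
  have hm0 : (0 : ℝ) < m := by exact_mod_cast Nat.pos_of_ne_zero hm
  unfold halfPow
  rw [← Complex.ofReal_mul, ← Real.rpow_add hm0]
  norm_num
  rw [Real.rpow_neg_one]
  push_cast
  rfl

/-- The sifted harmonic sum `S = Σ_{m ∈ 𝒩} 1/m`. [folklore] -/
def siftedSum (N Y : ℕ) : ℝ := ∑ m ∈ siftedSet N Y, 1 / (m : ℝ)

/-- `S ≥ 0`. [folklore] -/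
theorem siftedSum_nonneg (N Y : ℕ) : 0 ≤ siftedSum N Y :=
  Finset.sum_nonneg fun m _ ↦ by positivity

/-- The conjugate test polynomial on the critical line,
`Ḡ(t) = Σ_{m ∈ 𝒩} m^{-½} e^{+it log m} = conj (Σ_{m ∈ 𝒩} m^{-½-it})`. [folklore] -/
def testPolyConj (N Y : ℕ) (t : ℝ) : ℂ :=
  ∑ m ∈ siftedSet N Y, halfPow m * linePhase (-Real.log m) t

/-- `Ḡ` is continuous. [folklore] -/
theorem continuous_testPolyConj (N Y : ℕ) : Continuous (testPolyConj N Y) := by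
  unfold testPolyConj
  exact continuous_finsetSum _ fun m _ ↦ continuous_const.mul (continuous_linePhase _)

/-- `|Ḡ(t)| ≤ Σ_{m ∈ 𝒩} m^{-½} ≤ 2√Y`. [folklore] -/
theorem norm_testPolyConj_le (N Y : ℕ) (t : ℝ) : ‖testPolyConj N Y t‖ ≤ 2 * Real.sqrt Y := by
  unfold testPolyConj
  calc ‖∑ m ∈ siftedSet N Y, halfPow m * linePhase (-Real.log m) t‖
      ≤ ∑ m ∈ siftedSet N Y, (m : ℝ) ^ (-(1 / 2 : ℝ)) := by
        refine (norm_sum_le _ _).trans (Finset.sum_le_sum fun m _ ↦ ?_)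
        rw [norm_mul, norm_linePhase, mul_one, norm_halfPow]
    _ ≤ ∑ m ∈ Finset.Icc 1 Y, (m : ℝ) ^ (-(1 / 2 : ℝ)) :=
        Finset.sum_le_sum_of_subset_of_nonneg (siftedSet_subset_Icc N Y) fun m _ _ ↦
          Real.rpow_nonneg (Nat.cast_nonneg m) _
    _ ≤ 2 * Real.sqrt Y := Literature.NumberTheory.LFunctions.AFE.sum_Icc_rpow_neg_half_le Y

/-- The coefficients of `Ḡ` as a Dirichlet polynomial over `[1, Y]`. [folklore] -/
def testCoeff (N Y : ℕ) (n : ℕ) : ℂ := if n ∈ siftedSet N Y then halfPow n else 0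

/-- `Ḡ(t)` is the Dirichlet polynomial `Σ_{n ≤ Y} g(n) n^{-i(-t)}`. [folklore] -/
theorem testPolyConj_eq_sum (N Y : ℕ) (t : ℝ) :
    testPolyConj N Y t =
      ∑ n ∈ Finset.Icc 1 Y, testCoeff N Y n * (n : ℂ) ^ (-(((-t : ℝ) : ℂ) * I)) := by
  unfold testPolyConj testCoeff
  rw [← Finset.sum_subset (siftedSet_subset_Icc N Y) (f := fun n ↦
      (if n ∈ siftedSet N Y then halfPow n else 0) * (n : ℂ) ^ (-(((-t : ℝ) : ℂ) * I)))]
  · refine Finset.sum_congr rfl fun m hm ↦ ?_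
    rw [if_pos hm]
    congr 1
    have hm0 : m ≠ 0 := by have := two_le_of_mem_siftedSet hm; omega
    rw [Literature.NumberTheory.LFunctions.natCast_cpow_neg_mul_I hm0]
    unfold linePhase
    congr 1
    push_cast
    ring
  · intro n _ hn
    rw [if_neg hn, zero_mul]

/-- **Mean square of the test polynomial**: for `T ≥ 8`,
`∫_T^{2T} |Ḡ(t)|² dt ≤ (5T/2 + 65 Y) · S`. [folklore] -/
theorem integral_norm_sq_testPolyConj_le (N Y : ℕ) {T : ℝ} (hT : 8 ≤ T) :
    ∫ t in T..(2 * T), ‖testPolyConj N Y t‖ ^ 2 ≤ (5 * (T / 2) + 65 * Y) * siftedSum N Y := by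
  set D : ℝ → ℂ := fun u ↦ ∑ n ∈ Finset.Icc 1 Y, testCoeff N Y n * (n : ℂ) ^ (-((u : ℂ) * I))
    with hD
  have h1 : ∫ t in T..(2 * T), ‖testPolyConj N Y t‖ ^ 2 = ∫ t in T..(2 * T), ‖D (-t)‖ ^ 2 := by
    refine intervalIntegral.integral_congr fun t _ ↦ ?_
    simp only [hD]
    rw [testPolyConj_eq_sum]
  have h2 : ∫ t in T..(2 * T), ‖D (-t)‖ ^ 2 = ∫ u in (-(2 * T))..(-T), ‖D u‖ ^ 2 :=
    intervalIntegral.integral_comp_neg (fun u ↦ ‖D u‖ ^ 2)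
  have h3 := Literature.NumberTheory.LFunctions.DirichletMVT.meanSquare_shift_le_sharp
    (testCoeff N Y) Y (W := T / 2) (by linarith) (-(3 * T / 2))
  rw [show -(3 * T / 2) - T / 2 = -(2 * T) by ring, show -(3 * T / 2) + T / 2 = -T by ring] at h3
  rw [h1, h2]
  refine h3.trans ?_
  calc ∑ n ∈ Finset.Icc 1 Y, (5 * (T / 2) + 65 * n) * ‖testCoeff N Y n‖ ^ 2
      ≤ ∑ n ∈ Finset.Icc 1 Y, (5 * (T / 2) + 65 * Y) * ‖testCoeff N Y n‖ ^ 2 := by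
        refine Finset.sum_le_sum fun n hn ↦ ?_
        rw [Finset.mem_Icc] at hn
        have : (n : ℝ) ≤ Y := by exact_mod_cast hn.2
        gcongr
    _ = (5 * (T / 2) + 65 * Y) * ∑ n ∈ Finset.Icc 1 Y, ‖testCoeff N Y n‖ ^ 2 := by
        rw [Finset.mul_sum]
    _ = (5 * (T / 2) + 65 * Y) * siftedSum N Y := by
        congr 1
        unfold testCoeff siftedSum
        have : ∀ n ∈ Finset.Icc 1 Y, ‖(if n ∈ siftedSet N Y then halfPow n else 0)‖ ^ 2 =
            if n ∈ siftedSet N Y then 1 / (n : ℝ) else 0 := by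
          intro n hn
          rw [Finset.mem_Icc] at hn
          split_ifs
          · exact norm_halfPow_sq (by omega)
          · simp
        rw [Finset.sum_congr rfl this, Finset.sum_ite_mem,
          Finset.inter_eq_right.2 (siftedSet_subset_Icc N Y)]

/-! ## §4 Euler–Maclaurin on the dyadic interval -/

/-- The Dirichlet polynomial `D_L(t) = Σ_{1 ≤ n < L} n^{-½-it}` approximating `ζ(½+it)`.
[folklore] -/
def zetaSum (L : ℕ) (t : ℝ) : ℂ := ∑ n ∈ Finset.Ico 1 L, halfPow n * linePhase (Real.log n) t

/-- `D_L` is continuous. [folklore] -/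
theorem continuous_zetaSum (L : ℕ) : Continuous (zetaSum L) := by
  unfold zetaSum
  exact continuous_finsetSum _ fun n _ ↦ continuous_const.mul (continuous_linePhase _)

/-- `D_L(t) = Σ_{1 ≤ n < L} n^{-(½+it)}` in Mathlib's `cpow` form. [folklore] -/
theorem zetaSum_eq (L : ℕ) (t : ℝ) :
    zetaSum L t = ∑ n ∈ Finset.Ico 1 L, (n : ℂ) ^ (-(1 / 2 + t * I)) := by
  unfold zetaSum
  refine Finset.sum_congr rfl fun n hn ↦ ?_
  rw [Finset.mem_Ico] at hn
  rw [natCast_cpow_neg_half_line (by omega)]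

/-- The Euler–Maclaurin constant `C(1) = 1/2 + |B₂|/2! · 2 + 2³` of the tree's
`norm_zeta_sub_sum_sub_le` with `ν = 1`. [folklore] -/
def emC : ℝ :=
  (1 / 2 : ℝ) + ∑ k ∈ Finset.Icc 1 1, ‖((bernoulli (2 * k) : ℚ) : ℂ) / (2 * k).factorial‖ *
    2 ^ (2 * k - 1) + 2 ^ (2 * 1 + 1)

/-- `C(1) ≥ 0`. [folklore] -/
theorem emC_nonneg : 0 ≤ emC :=
  Literature.NumberTheory.LFunctions.EulerProductMeanSquare.emConst_nonneg 1

/-- **Euler–Maclaurin on `[T, 2T]`** (the tree's `norm_zeta_sub_sum_sub_le` with `σ = ½`,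
`a = 3/2`, `ν = 1`, `N = L ≥ (2T)^{3/2}`, and the polar term `L^{½-it}/(-½+it)` absorbed):
for `T ≥ 2`, `t ∈ [T, 2T]` and `(2T)^{3/2} ≤ L ≤ (2T)^{3/2} + 1`,
`‖ζ(½+it) − D_L(t)‖ ≤ (C(1) + 3) T^{-1/4}`. [cite: Titchmarsh1986, Thm. 4.11] -/
theorem norm_zeta_sub_zetaSum_le {T t : ℝ} (hT : 2 ≤ T) (ht : t ∈ Set.Icc T (2 * T)) {L : ℕ}
    (hL : (2 * T) ^ (3 / 2 : ℝ) ≤ L) (hL' : (L : ℝ) ≤ (2 * T) ^ (3 / 2 : ℝ) + 1) :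
    ‖riemannZeta (1 / 2 + t * I) - zetaSum L t‖ ≤ (emC + 3) * T ^ (-(1 / 4 : ℝ)) := by
  have hT0 : 0 < T := by linarith
  have ht1 : 1 ≤ t := by linarith [ht.1]
  have ht0 : 0 < t := by linarith
  have h := Literature.NumberTheory.LFunctions.EulerProductMeanSquare.norm_zeta_sub_sum_sub_le
    (σ := 1 / 2) (a := 3 / 2) (by norm_num) (by norm_num) (by norm_num) (ν := 1) le_rfl
    (by norm_num) (T := 2 * T) (t := t) (by push_cast; linarith) ht1 ht.2 (N := L) hL
  have hs : ((1 / 2 : ℝ) : ℂ) + (t : ℂ) * I = 1 / 2 + (t : ℂ) * I := by push_cast; ring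
  rw [hs] at h
  rw [show (2 : ℕ) * 1 + 1 = 2 * 1 + 1 from rfl] at h
  have hsum : ∑ n ∈ Finset.Ico 1 L, (n : ℂ) ^ (-(1 / 2 + (t : ℂ) * I)) = zetaSum L t :=
    (zetaSum_eq L t).symm
  rw [hsum] at h
  -- the polar term
  have hL0 : (0 : ℝ) < L := lt_of_lt_of_le (by positivity) hL
  have hLn : 0 < L := by exact_mod_cast hL0
  set P : ℂ := (L : ℂ) ^ (1 - (1 / 2 + (t : ℂ) * I)) / (1 / 2 + (t : ℂ) * I - 1) with hP
  have hPn : ‖P‖ ≤ ((2 * T) ^ (3 / 4 : ℝ) + 1) / T := by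
    rw [hP, norm_div, Complex.norm_natCast_cpow_of_pos hLn]
    have hre : (1 - (1 / 2 + (t : ℂ) * I)).re = 1 / 2 := by simp; norm_num
    rw [hre]
    have hden : T ≤ ‖1 / 2 + (t : ℂ) * I - 1‖ := by
      have him : (1 / 2 + (t : ℂ) * I - 1).im = t := by simp
      have := Complex.abs_im_le_norm (1 / 2 + (t : ℂ) * I - 1)
      rw [him, abs_of_pos ht0] at this
      linarith [ht.1]
    have hnum : (L : ℝ) ^ (1 / 2 : ℝ) ≤ (2 * T) ^ (3 / 4 : ℝ) + 1 := by
      have h1 : (L : ℝ) ^ (1 / 2 : ℝ) ≤ ((2 * T) ^ (3 / 2 : ℝ) + 1) ^ (1 / 2 : ℝ) :=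
        Real.rpow_le_rpow hL0.le hL' (by norm_num)
      have h2 : ((2 * T) ^ (3 / 2 : ℝ) + 1) ^ (1 / 2 : ℝ) ≤ (2 * T) ^ (3 / 4 : ℝ) + 1 := by
        have hA : 0 ≤ (2 * T) ^ (3 / 4 : ℝ) := Real.rpow_nonneg (by positivity) _
        have hsq : ((2 * T) ^ (3 / 4 : ℝ) + 1) ^ (2 : ℝ) ≥ (2 * T) ^ (3 / 2 : ℝ) + 1 := by
          rw [show (2 : ℝ) = (2 : ℕ) from by norm_num, Real.rpow_natCast, add_sq,
            ← Real.rpow_natCast, ← Real.rpow_mul (by positivity)]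
          norm_num
          nlinarith
        calc ((2 * T) ^ (3 / 2 : ℝ) + 1) ^ (1 / 2 : ℝ)
            ≤ (((2 * T) ^ (3 / 4 : ℝ) + 1) ^ (2 : ℝ)) ^ (1 / 2 : ℝ) :=
              Real.rpow_le_rpow (by positivity) hsq (by norm_num)
          _ = (2 * T) ^ (3 / 4 : ℝ) + 1 := by
              rw [← Real.rpow_mul (by positivity)]; norm_num
      exact h1.trans h2
    calc (L : ℝ) ^ (1 / 2 : ℝ) / ‖1 / 2 + (t : ℂ) * I - 1‖
        ≤ (L : ℝ) ^ (1 / 2 : ℝ) / T := div_le_div_of_nonneg_left (by positivity) hT0 hden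
      _ ≤ ((2 * T) ^ (3 / 4 : ℝ) + 1) / T := div_le_div_of_nonneg_right hnum hT0.le
  -- numerics: `(2T)^{3/4} + 1 ≤ 3 T^{3/4}`, `(2T)^{-3/4} ≤ T^{-1/4}`
  have hT1 : 1 ≤ T := by linarith
  have h34 : (2 * T) ^ (3 / 4 : ℝ) + 1 ≤ 3 * T ^ (3 / 4 : ℝ) := by
    rw [Real.mul_rpow (by norm_num) hT0.le]
    have h2 : (2 : ℝ) ^ (3 / 4 : ℝ) ≤ 2 := by
      calc (2 : ℝ) ^ (3 / 4 : ℝ) ≤ (2 : ℝ) ^ (1 : ℝ) :=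
            Real.rpow_le_rpow_of_exponent_le (by norm_num) (by norm_num)
        _ = 2 := Real.rpow_one 2
    have h3 : 1 ≤ T ^ (3 / 4 : ℝ) := Real.one_le_rpow hT1 (by norm_num)
    nlinarith [Real.rpow_nonneg hT0.le (3 / 4 : ℝ)]
  have hpow1 : T ^ (3 / 4 : ℝ) / T = T ^ (-(1 / 4 : ℝ)) := by
    rw [div_eq_mul_inv, ← Real.rpow_neg_one, ← Real.rpow_add hT0]; norm_num
  have hpow2 : (2 * T) ^ (-(3 / 2 * (1 / 2) : ℝ)) ≤ T ^ (-(1 / 4 : ℝ)) := by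
    calc (2 * T) ^ (-(3 / 2 * (1 / 2) : ℝ)) ≤ T ^ (-(3 / 2 * (1 / 2) : ℝ)) :=
          Real.rpow_le_rpow_of_nonpos hT0 (by linarith) (by norm_num)
      _ ≤ T ^ (-(1 / 4 : ℝ)) := Real.rpow_le_rpow_of_exponent_le hT1 (by norm_num)
  have hTq : 0 ≤ T ^ (-(1 / 4 : ℝ)) := Real.rpow_nonneg hT0.le _
  -- combine
  have hkey : riemannZeta (1 / 2 + ↑t * I) - zetaSum L t =
      (riemannZeta (1 / 2 + ↑t * I) - zetaSum L t - P) + P := by ring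
  rw [hkey]
  calc ‖riemannZeta (1 / 2 + ↑t * I) - zetaSum L t - P + P‖
      ≤ ‖riemannZeta (1 / 2 + ↑t * I) - zetaSum L t - P‖ + ‖P‖ := norm_add_le _ _
    _ ≤ emC * (2 * T) ^ (-(3 / 2 * (1 / 2) : ℝ)) + ((2 * T) ^ (3 / 4 : ℝ) + 1) / T :=
        add_le_add h hPn
    _ ≤ emC * T ^ (-(1 / 4 : ℝ)) + 3 * T ^ (3 / 4 : ℝ) / T := by
        gcongr
        · exact emC_nonneg
    _ = (emC + 3) * T ^ (-(1 / 4 : ℝ)) := by rw [mul_div_assoc, hpow1]; ring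

/-- `ζ(½+it)` is bounded on `[T, 2T]` by `|D_L| + (C(1)+3)T^{-1/4} ≤ 2√L + C(1) + 3`; we only need
the cruder consequence that `|ζ(½+it) − D_L(t)| ≤ C(1) + 3` there (`T ≥ 2`). [folklore] -/
theorem norm_zeta_sub_zetaSum_le' {T t : ℝ} (hT : 2 ≤ T) (ht : t ∈ Set.Icc T (2 * T)) {L : ℕ}
    (hL : (2 * T) ^ (3 / 2 : ℝ) ≤ L) (hL' : (L : ℝ) ≤ (2 * T) ^ (3 / 2 : ℝ) + 1) :
    ‖riemannZeta (1 / 2 + t * I) - zetaSum L t‖ ≤ emC + 3 := by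
  refine (norm_zeta_sub_zetaSum_le hT ht hL hL').trans ?_
  have h1 : T ^ (-(1 / 4 : ℝ)) ≤ 1 :=
    Real.rpow_le_one_of_one_le_of_nonpos (by linarith) (by norm_num)
  have h0 := emC_nonneg
  nlinarith

/-! ## §5 The twisted first moment: diagonal and off-diagonal -/

/-- The coefficient of the `(n, d, m)` term of `D_L · M · Ḡ`. [folklore] -/
def tripleCoeff (a : ℕ → ℂ) (n d m : ℕ) : ℂ := a d * halfPow d * halfPow m * halfPow n

/-- The frequency `log n + log d − log m` of the `(n, d, m)` term. [folklore] -/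
def tripleFreq (n d m : ℕ) : ℝ := Real.log n + Real.log d - Real.log m

/-- `M(½+it) = Σ_{d ≤ N} a(d) d^{-½} e^{-it log d}`. [folklore] -/
theorem mollifierLine_eq_sum (a : ℕ → ℂ) (N : ℕ) (t : ℝ) :
    mollifierLine a N t = ∑ d ∈ Finset.Icc 1 N, a d * halfPow d * linePhase (Real.log d) t := by
  unfold mollifierLine dirichletMollifier
  refine Finset.sum_congr rfl fun d hd ↦ ?_
  rw [Finset.mem_Icc] at hd
  rw [natCast_cpow_neg_half_line (by omega), mul_assoc]

/-- **Expansion of the integrand**: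
`D_L(t) M(t) Ḡ(t) = Σ_{d ≤ N} Σ_{m ∈ 𝒩} Σ_{n < L} c(n,d,m) e^{-it(log n + log d − log m)}`.
[folklore] -/
theorem zetaSum_mul_mul_eq (a : ℕ → ℂ) (N Y L : ℕ) (t : ℝ) :
    zetaSum L t * mollifierLine a N t * testPolyConj N Y t =
      ∑ d ∈ Finset.Icc 1 N, ∑ m ∈ siftedSet N Y, ∑ n ∈ Finset.Ico 1 L,
        tripleCoeff a n d m * linePhase (tripleFreq n d m) t := by
  rw [mollifierLine_eq_sum, zetaSum, testPolyConj, Finset.sum_mul_sum, Finset.sum_mul]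
  simp_rw [Finset.sum_mul, Finset.mul_sum]
  rw [Finset.sum_comm]
  refine Finset.sum_congr rfl fun d _ ↦ ?_
  rw [Finset.sum_comm]
  refine Finset.sum_congr rfl fun m _ ↦ Finset.sum_congr rfl fun n _ ↦ ?_
  unfold tripleCoeff tripleFreq
  rw [sub_eq_add_neg, linePhase_add, linePhase_add]
  ring

/-- The phase integral over `[T, 2T]`. [folklore] -/
def phaseInt (T : ℝ) (n d m : ℕ) : ℂ := ∫ t in T..(2 * T), linePhase (tripleFreq n d m) t

/-- **The twisted first moment as a triple sum**:
`∫_T^{2T} D_L M Ḡ dt = Σ_d Σ_m Σ_n c(n,d,m) ∫_T^{2T} e^{-itν(n,d,m)} dt`. [folklore] -/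
theorem integral_zetaSum_mul_mul_eq (a : ℕ → ℂ) (N Y L : ℕ) (T : ℝ) :
    ∫ t in T..(2 * T), zetaSum L t * mollifierLine a N t * testPolyConj N Y t =
      ∑ d ∈ Finset.Icc 1 N, ∑ m ∈ siftedSet N Y, ∑ n ∈ Finset.Ico 1 L,
        tripleCoeff a n d m * phaseInt T n d m := by
  simp_rw [zetaSum_mul_mul_eq]
  have hint : ∀ n d m : ℕ, IntervalIntegrable
      (fun t : ℝ ↦ tripleCoeff a n d m * linePhase (tripleFreq n d m) t) volume T (2 * T) :=
    fun n d m ↦ (continuous_const.mul (continuous_linePhase _)).intervalIntegrable _ _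
  rw [intervalIntegral.integral_finsetSum]
  · refine Finset.sum_congr rfl fun d _ ↦ ?_
    rw [intervalIntegral.integral_finsetSum]
    · refine Finset.sum_congr rfl fun m _ ↦ ?_
      rw [intervalIntegral.integral_finsetSum]
      · refine Finset.sum_congr rfl fun n _ ↦ ?_
        unfold phaseInt
        exact intervalIntegral.integral_const_mul _ _
      · exact fun n _ ↦ hint n d m
    · exact fun m _ ↦ (continuous_finsetSum _ fun n _ ↦
        continuous_const.mul (continuous_linePhase _)).intervalIntegrable _ _
  · exact fun d _ ↦ (continuous_finsetSum _ fun m _ ↦ continuous_finsetSum _ fun n _ ↦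
      continuous_const.mul (continuous_linePhase _)).intervalIntegrable _ _

/-- The frequency in closed form: `ν(n,d,m) = log (nd) − log m`. [folklore] -/
theorem tripleFreq_eq {n d : ℕ} (hn : n ≠ 0) (hd : d ≠ 0) (m : ℕ) :
    tripleFreq n d m = Real.log ((n * d : ℕ) : ℝ) - Real.log m := by
  unfold tripleFreq
  push_cast
  rw [Real.log_mul (by exact_mod_cast hn) (by exact_mod_cast hd)]

/-- On the diagonal `nd = m` the frequency vanishes and the phase integral is `T`. [folklore] -/
theorem phaseInt_of_eq {T : ℝ} {n d m : ℕ} (hn : n ≠ 0) (hd : d ≠ 0) (h : n * d = m) :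
    phaseInt T n d m = (T : ℂ) := by
  unfold phaseInt
  rw [tripleFreq_eq hn hd, h, sub_self, integral_linePhase_zero]
  push_cast; ring

/-- Off the diagonal: `‖∫_T^{2T} e^{-itν}‖ ≤ 2/|ν| ≤ 4m`. [folklore] -/
theorem norm_phaseInt_le_of_ne {T : ℝ} {n d m : ℕ} (hn : n ≠ 0) (hd : d ≠ 0) (hm : m ≠ 0)
    (h : n * d ≠ m) : ‖phaseInt T n d m‖ ≤ 4 * m := by
  have hfreq : 1 / (2 * (m : ℝ)) ≤ |tripleFreq n d m| := by
    rw [tripleFreq_eq hn hd]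
    exact inv_two_mul_le_abs_log_sub (Nat.pos_of_ne_zero (mul_ne_zero hn hd))
      (Nat.pos_of_ne_zero hm) h
  have hm0 : (0 : ℝ) < m := by exact_mod_cast Nat.pos_of_ne_zero hm
  have hpos : 0 < 1 / (2 * (m : ℝ)) := by positivity
  have hν : tripleFreq n d m ≠ 0 := by
    intro h0; rw [h0, abs_zero] at hfreq; linarith
  unfold phaseInt
  refine (norm_integral_linePhase_le hν _ _).trans ?_
  rw [div_le_iff₀ (lt_of_lt_of_le hpos hfreq)]
  calc (2 : ℝ) = 4 * m * (1 / (2 * m)) := by field_simp; ring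
    _ ≤ 4 * m * |tripleFreq n d m| := by gcongr

/-- Far off the diagonal (`n ≥ 2m`): `‖∫_T^{2T} e^{-itν}‖ ≤ 2/log 2 ≤ 4`. [folklore] -/
theorem norm_phaseInt_le_of_le {T : ℝ} {n d m : ℕ} (hd : d ≠ 0) (hm : m ≠ 0)
    (h : 2 * m ≤ n) : ‖phaseInt T n d m‖ ≤ 4 := by
  have hn : n ≠ 0 := by omega
  have hfreq : Real.log 2 ≤ tripleFreq n d m := by
    rw [tripleFreq_eq hn hd]
    refine log_two_le_log_sub (Nat.pos_of_ne_zero hm) ?_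
    calc 2 * m ≤ n := h
      _ = n * 1 := (mul_one n).symm
      _ ≤ n * d := Nat.mul_le_mul_left n (Nat.pos_of_ne_zero hd)
  have h2 := half_le_log_two
  have hν : tripleFreq n d m ≠ 0 := by intro h0; rw [h0] at hfreq; linarith
  unfold phaseInt
  refine (norm_integral_linePhase_le hν _ _).trans ?_
  rw [abs_of_pos (by linarith), div_le_iff₀ (by linarith)]
  linarith

/-- `‖c(n,d,m)‖ ≤ ‖a d‖ · m^{-½} · n^{-½}` (dropping `d^{-½} ≤ 1`). [folklore] -/
theorem norm_tripleCoeff_le (a : ℕ → ℂ) {n d m : ℕ} (hd : d ≠ 0) :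
    ‖tripleCoeff a n d m‖ ≤ ‖a d‖ * (m : ℝ) ^ (-(1 / 2 : ℝ)) * (n : ℝ) ^ (-(1 / 2 : ℝ)) := by
  unfold tripleCoeff
  rw [norm_mul, norm_mul, norm_mul, norm_halfPow m, norm_halfPow n]
  have h1 : ‖halfPow d‖ ≤ 1 := norm_halfPow_le hd
  have h0 : 0 ≤ ‖a d‖ := norm_nonneg _
  have hm : 0 ≤ (m : ℝ) ^ (-(1 / 2 : ℝ)) := Real.rpow_nonneg (Nat.cast_nonneg m) _
  have hn : 0 ≤ (n : ℝ) ^ (-(1 / 2 : ℝ)) := Real.rpow_nonneg (Nat.cast_nonneg n) _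
  calc ‖a d‖ * ‖halfPow d‖ * (m : ℝ) ^ (-(1 / 2 : ℝ)) * (n : ℝ) ^ (-(1 / 2 : ℝ))
      ≤ ‖a d‖ * 1 * (m : ℝ) ^ (-(1 / 2 : ℝ)) * (n : ℝ) ^ (-(1 / 2 : ℝ)) := by gcongr
    _ = _ := by rw [mul_one]

/-- **The diagonal.** For `d ≤ N`, `m ∈ 𝒩` with `m < L`: the terms `n` with `nd = m` contribute
`T/m` if `d = 1` (then `n = m`) and nothing if `d ≥ 2` (a divisor `d ≤ N` of a sifted `m` is `1`).
[folklore] -/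
theorem sum_filter_eq_diag (a : ℕ → ℂ) (ha1 : a 1 = 1) {N Y L : ℕ} {T : ℝ} {d m : ℕ}
    (hd : d ∈ Finset.Icc 1 N) (hm : m ∈ siftedSet N Y) (hmL : m < L) :
    ∑ n ∈ (Finset.Ico 1 L).filter (fun n ↦ n * d = m), tripleCoeff a n d m * phaseInt T n d m =
      if d = 1 then (((T / m : ℝ)) : ℂ) else 0 := by
  rw [Finset.mem_Icc] at hd
  have hm2 := two_le_of_mem_siftedSet hm
  split_ifs with hd1
  · subst hd1
    have hfilter : (Finset.Ico 1 L).filter (fun n ↦ n * 1 = m) = {m} := by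
      ext n
      simp only [Finset.mem_filter, Finset.mem_Ico, Finset.mem_singleton, mul_one]
      constructor
      · exact fun h ↦ h.2
      · intro h; subst h; exact ⟨⟨by omega, hmL⟩, rfl⟩
    rw [hfilter, Finset.sum_singleton, phaseInt_of_eq (by omega) one_ne_zero (mul_one m)]
    unfold tripleCoeff
    rw [ha1, halfPow_one, one_mul, one_mul, halfPow_mul_self (by omega)]
    push_cast
    ring
  · have hfilter : (Finset.Ico 1 L).filter (fun n ↦ n * d = m) = ∅ := by
      rw [Finset.filter_eq_empty_iff]
      intro n _ hnd
      exact hd1 (eq_one_of_dvd_of_mem_siftedSet hm hd.2 ⟨n, by rw [mul_comm]; exact hnd.symm⟩)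
    rw [hfilter, Finset.sum_empty]

/-- `Σ_{n ∈ [1, X]} n^{-½}` with `X` given as a real bound: for `s ⊆ [1, X]`,
`Σ_{n ∈ s} n^{-½} ≤ 2 √X`. [folklore] -/
theorem sum_rpow_neg_half_le_of_subset {s : Finset ℕ} {X : ℕ} (hs : s ⊆ Finset.Icc 1 X) :
    ∑ n ∈ s, (n : ℝ) ^ (-(1 / 2 : ℝ)) ≤ 2 * Real.sqrt X :=
  (Finset.sum_le_sum_of_subset_of_nonneg hs fun n _ _ ↦ Real.rpow_nonneg (Nat.cast_nonneg n) _).trans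
    (Literature.NumberTheory.LFunctions.AFE.sum_Icc_rpow_neg_half_le X)

/-- **The off-diagonal terms for fixed `d`, `m`**:
`Σ_{n < L, nd ≠ m} ‖c(n,d,m)‖ ‖∫ e^{-itν}‖ ≤ ‖a d‖ m^{-½} (8 m √(2m) + 8 √L)`
(`‖∫‖ ≤ 4m` for `n < 2m`, `≤ 4` for `n ≥ 2m`, and `Σ_{n ≤ X} n^{-½} ≤ 2√X`). [folklore] -/
theorem norm_sum_offDiag_le (a : ℕ → ℂ) {N Y L : ℕ} {T : ℝ} {d m : ℕ} (hd : d ≠ 0)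
    (hm : m ∈ siftedSet N Y) :
    ‖∑ n ∈ (Finset.Ico 1 L).filter (fun n ↦ n * d ≠ m), tripleCoeff a n d m * phaseInt T n d m‖ ≤
      ‖a d‖ * (m : ℝ) ^ (-(1 / 2 : ℝ)) *
        (8 * m * Real.sqrt ((2 * m : ℕ) : ℝ) + 8 * Real.sqrt L) := by
  have hm2 := two_le_of_mem_siftedSet hm
  have hm0 : m ≠ 0 := by omega
  set B : ℕ → ℝ := fun n ↦ ‖a d‖ * (m : ℝ) ^ (-(1 / 2 : ℝ)) * ((n : ℝ) ^ (-(1 / 2 : ℝ)) *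
    ((if n < 2 * m then 4 * (m : ℝ) else 0) + 4)) with hB
  have hB0 : ∀ n, 0 ≤ B n := fun n ↦ by
    simp only [hB]
    have : 0 ≤ (if n < 2 * m then 4 * (m : ℝ) else 0) := by split_ifs <;> positivity
    positivity
  -- termwise bound
  have hterm : ∀ n ∈ (Finset.Ico 1 L).filter (fun n ↦ n * d ≠ m),
      ‖tripleCoeff a n d m * phaseInt T n d m‖ ≤ B n := by
    intro n hn
    rw [Finset.mem_filter, Finset.mem_Ico] at hn
    have hn0 : n ≠ 0 := by omega
    have hph : ‖phaseInt T n d m‖ ≤ (if n < 2 * m then 4 * (m : ℝ) else 0) + 4 := by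
      split_ifs with h2
      · calc ‖phaseInt T n d m‖ ≤ 4 * m := norm_phaseInt_le_of_ne hn0 hd hm0 hn.2
          _ ≤ 4 * m + 4 := by linarith
      · rw [zero_add]
        exact norm_phaseInt_le_of_le hd hm0 (by omega)
    rw [norm_mul]
    calc ‖tripleCoeff a n d m‖ * ‖phaseInt T n d m‖
        ≤ (‖a d‖ * (m : ℝ) ^ (-(1 / 2 : ℝ)) * (n : ℝ) ^ (-(1 / 2 : ℝ))) *
            ((if n < 2 * m then 4 * (m : ℝ) else 0) + 4) :=
          mul_le_mul (norm_tripleCoeff_le a hd) hph (norm_nonneg _) (by positivity)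
      _ = B n := by simp only [hB]; ring
  refine (norm_sum_le _ _).trans ((Finset.sum_le_sum hterm).trans ?_)
  -- extend the sum to all `n < L` and evaluate
  calc ∑ n ∈ (Finset.Ico 1 L).filter (fun n ↦ n * d ≠ m), B n
      ≤ ∑ n ∈ Finset.Ico 1 L, B n :=
        Finset.sum_le_sum_of_subset_of_nonneg (Finset.filter_subset _ _) fun n _ _ ↦ hB0 n
    _ = ‖a d‖ * (m : ℝ) ^ (-(1 / 2 : ℝ)) *
          (∑ n ∈ Finset.Ico 1 L, (n : ℝ) ^ (-(1 / 2 : ℝ)) * (if n < 2 * m then 4 * (m : ℝ) else 0) +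
            4 * ∑ n ∈ Finset.Ico 1 L, (n : ℝ) ^ (-(1 / 2 : ℝ))) := by
        rw [hB, ← Finset.mul_sum]
        congr 1
        rw [Finset.mul_sum, ← Finset.sum_add_distrib]
        refine Finset.sum_congr rfl fun n _ ↦ by ring
    _ ≤ ‖a d‖ * (m : ℝ) ^ (-(1 / 2 : ℝ)) *
          (4 * m * (2 * Real.sqrt ((2 * m : ℕ) : ℝ)) + 4 * (2 * Real.sqrt L)) := by
        have h0 : 0 ≤ ‖a d‖ * (m : ℝ) ^ (-(1 / 2 : ℝ)) := by positivity
        refine mul_le_mul_of_nonneg_left (add_le_add ?_ ?_) h0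
        · -- the terms `n < 2m`
          have : ∑ n ∈ Finset.Ico 1 L, (n : ℝ) ^ (-(1 / 2 : ℝ)) *
              (if n < 2 * m then 4 * (m : ℝ) else 0) =
              4 * m * ∑ n ∈ (Finset.Ico 1 L).filter (fun n ↦ n < 2 * m),
                (n : ℝ) ^ (-(1 / 2 : ℝ)) := by
            rw [Finset.mul_sum, Finset.sum_filter]
            refine Finset.sum_congr rfl fun n _ ↦ ?_
            split_ifs <;> ring
          rw [this]
          refine mul_le_mul_of_nonneg_left (sum_rpow_neg_half_le_of_subset ?_) (by positivity)
          intro n hn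
          rw [Finset.mem_filter, Finset.mem_Ico] at hn
          rw [Finset.mem_Icc]; omega
        · refine mul_le_mul_of_nonneg_left (sum_rpow_neg_half_le_of_subset ?_) (by norm_num)
          intro n hn
          rw [Finset.mem_Ico] at hn
          rw [Finset.mem_Icc]; omega
    _ = _ := by ring

/-- Summing the off-diagonal bound over `m ∈ 𝒩`:
`Σ_{m ∈ 𝒩} m^{-½} (8 m √(2m) + 8 √L) ≤ 8√2 · Y² + 16 √L √Y`. [folklore] -/
theorem sum_offDiag_weight_le (N Y L : ℕ) :
    ∑ m ∈ siftedSet N Y, (m : ℝ) ^ (-(1 / 2 : ℝ)) *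
        (8 * m * Real.sqrt ((2 * m : ℕ) : ℝ) + 8 * Real.sqrt L) ≤
      8 * Real.sqrt 2 * (Y : ℝ) ^ 2 + 16 * Real.sqrt L * Real.sqrt Y := by
  have hY : ∀ m ∈ siftedSet N Y, (m : ℝ) ^ (-(1 / 2 : ℝ)) * (8 * m * Real.sqrt ((2 * m : ℕ) : ℝ)) =
      8 * Real.sqrt 2 * m := by
    intro m hm
    have hm0 : (0 : ℝ) < m := by exact_mod_cast (show 0 < m by have := two_le_of_mem_siftedSet hm; omega)
    push_cast
    rw [Real.sqrt_mul (by norm_num), Real.sqrt_eq_rpow, Real.sqrt_eq_rpow]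
    have : (m : ℝ) ^ (-(1 / 2 : ℝ)) * (m : ℝ) ^ (1 / 2 : ℝ) = 1 := by
      rw [← Real.rpow_add hm0]; norm_num
    calc (m : ℝ) ^ (-(1 / 2 : ℝ)) * (8 * m * ((2 : ℝ) ^ (1 / 2 : ℝ) * (m : ℝ) ^ (1 / 2 : ℝ)))
        = 8 * (2 : ℝ) ^ (1 / 2 : ℝ) * m * ((m : ℝ) ^ (-(1 / 2 : ℝ)) * (m : ℝ) ^ (1 / 2 : ℝ)) := by
          ring
      _ = 8 * (2 : ℝ) ^ (1 / 2 : ℝ) * m := by rw [this, mul_one]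
  rw [Finset.sum_congr rfl fun m hm ↦ by rw [mul_add, hY m hm], Finset.sum_add_distrib]
  apply add_le_add
  · rw [← Finset.mul_sum]
    have hsum : ∑ m ∈ siftedSet N Y, (m : ℝ) ≤ (Y : ℝ) ^ 2 := by
      calc ∑ m ∈ siftedSet N Y, (m : ℝ) ≤ ∑ m ∈ siftedSet N Y, (Y : ℝ) :=
            Finset.sum_le_sum fun m hm ↦ by exact_mod_cast le_of_mem_siftedSet hm
        _ = (siftedSet N Y).card * Y := by rw [Finset.sum_const, nsmul_eq_mul]
        _ ≤ Y * Y := by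
            have h1 : (siftedSet N Y).card ≤ Y :=
              (Finset.card_le_card (siftedSet_subset_Icc N Y)).trans (by simp)
            have h2 : ((siftedSet N Y).card : ℝ) ≤ Y := by exact_mod_cast h1
            exact mul_le_mul_of_nonneg_right h2 (Nat.cast_nonneg Y)
        _ = (Y : ℝ) ^ 2 := (sq _).symm
    exact mul_le_mul_of_nonneg_left hsum (by positivity)
  · have : ∑ m ∈ siftedSet N Y, (m : ℝ) ^ (-(1 / 2 : ℝ)) * (8 * Real.sqrt L) =
        8 * Real.sqrt L * ∑ m ∈ siftedSet N Y, (m : ℝ) ^ (-(1 / 2 : ℝ)) := by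
      rw [Finset.mul_sum]; refine Finset.sum_congr rfl fun m _ ↦ by ring
    rw [this]
    calc 8 * Real.sqrt L * ∑ m ∈ siftedSet N Y, (m : ℝ) ^ (-(1 / 2 : ℝ))
        ≤ 8 * Real.sqrt L * (2 * Real.sqrt Y) :=
          mul_le_mul_of_nonneg_left (sum_rpow_neg_half_le_of_subset (siftedSet_subset_Icc N Y))
            (by positivity)
      _ = 16 * Real.sqrt L * Real.sqrt Y := by ring

/-- `A₀ = Σ_{d ≤ N} ‖a d‖`, the `ℓ¹` norm of the mollifier coefficients. [folklore] -/
def coeffSum (a : ℕ → ℂ) (N : ℕ) : ℝ := ∑ d ∈ Finset.Icc 1 N, ‖a d‖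

/-- `A₀ ≥ 0`. [folklore] -/
theorem coeffSum_nonneg (a : ℕ → ℂ) (N : ℕ) : 0 ≤ coeffSum a N :=
  Finset.sum_nonneg fun _ _ ↦ norm_nonneg _

/-- The off-diagonal part of the twisted first moment. [folklore] -/
def offDiag (a : ℕ → ℂ) (N Y L : ℕ) (T : ℝ) : ℂ :=
  ∑ d ∈ Finset.Icc 1 N, ∑ m ∈ siftedSet N Y,
    ∑ n ∈ (Finset.Ico 1 L).filter (fun n ↦ n * d ≠ m), tripleCoeff a n d m * phaseInt T n d m

/-- **Off-diagonal bound**: `‖OD‖ ≤ A₀ · (8√2 Y² + 16 √L √Y)`. [folklore] -/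
theorem norm_offDiag_le (a : ℕ → ℂ) (N Y L : ℕ) (T : ℝ) :
    ‖offDiag a N Y L T‖ ≤
      coeffSum a N * (8 * Real.sqrt 2 * (Y : ℝ) ^ 2 + 16 * Real.sqrt L * Real.sqrt Y) := by
  unfold offDiag coeffSum
  rw [Finset.sum_mul]
  refine (norm_sum_le _ _).trans (Finset.sum_le_sum fun d hd ↦ ?_)
  rw [Finset.mem_Icc] at hd
  refine (norm_sum_le _ _).trans ?_
  calc ∑ m ∈ siftedSet N Y, ‖∑ n ∈ (Finset.Ico 1 L).filter (fun n ↦ n * d ≠ m),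
          tripleCoeff a n d m * phaseInt T n d m‖
      ≤ ∑ m ∈ siftedSet N Y, ‖a d‖ * (m : ℝ) ^ (-(1 / 2 : ℝ)) *
          (8 * m * Real.sqrt ((2 * m : ℕ) : ℝ) + 8 * Real.sqrt L) :=
        Finset.sum_le_sum fun m hm ↦ norm_sum_offDiag_le a (by omega) hm
    _ = ‖a d‖ * ∑ m ∈ siftedSet N Y, (m : ℝ) ^ (-(1 / 2 : ℝ)) *
          (8 * m * Real.sqrt ((2 * m : ℕ) : ℝ) + 8 * Real.sqrt L) := by
        rw [Finset.mul_sum]; refine Finset.sum_congr rfl fun m _ ↦ by ring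
    _ ≤ ‖a d‖ * (8 * Real.sqrt 2 * (Y : ℝ) ^ 2 + 16 * Real.sqrt L * Real.sqrt Y) :=
        mul_le_mul_of_nonneg_left (sum_offDiag_weight_le N Y L) (norm_nonneg _)

/-- **The twisted first moment**: for `N ≥ 1`, `Y < L` and `a(1) = 1`,
`∫_T^{2T} D_L M Ḡ dt = T · S + OD`. [folklore] -/
theorem integral_zetaSum_mul_mul_eq_diag_add (a : ℕ → ℂ) (ha1 : a 1 = 1) {N Y L : ℕ}
    (hN : 1 ≤ N) (hYL : Y < L) (T : ℝ) :
    ∫ t in T..(2 * T), zetaSum L t * mollifierLine a N t * testPolyConj N Y t =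
      ((T * siftedSum N Y : ℝ) : ℂ) + offDiag a N Y L T := by
  rw [integral_zetaSum_mul_mul_eq]
  have hsplit : ∀ d ∈ Finset.Icc 1 N, ∀ m ∈ siftedSet N Y,
      ∑ n ∈ Finset.Ico 1 L, tripleCoeff a n d m * phaseInt T n d m =
        (if d = 1 then (((T / m : ℝ)) : ℂ) else 0) +
          ∑ n ∈ (Finset.Ico 1 L).filter (fun n ↦ n * d ≠ m),
            tripleCoeff a n d m * phaseInt T n d m := by
    intro d hd m hm
    rw [← Finset.sum_filter_add_sum_filter_not (Finset.Ico 1 L) (fun n ↦ n * d = m),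
      sum_filter_eq_diag a ha1 hd hm (lt_of_le_of_lt (le_of_mem_siftedSet hm) hYL)]
  rw [Finset.sum_congr rfl fun d hd ↦ Finset.sum_congr rfl fun m hm ↦ hsplit d hd m hm]
  simp_rw [Finset.sum_add_distrib]
  unfold offDiag
  congr 1
  -- the diagonal sums to `T · S`
  have hdiag : ∀ d ∈ Finset.Icc 1 N,
      ∑ m ∈ siftedSet N Y, (if d = 1 then (((T / m : ℝ)) : ℂ) else 0) =
        if d = 1 then ∑ m ∈ siftedSet N Y, (((T / m : ℝ)) : ℂ) else 0 := by
    intro d hd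
    split_ifs <;> simp
  rw [Finset.sum_congr rfl hdiag, Finset.sum_ite_eq' (Finset.Icc 1 N) 1
    (fun _ ↦ ∑ m ∈ siftedSet N Y, (((T / m : ℝ)) : ℂ)), if_pos (Finset.mem_Icc.2 ⟨le_rfl, hN⟩)]
  unfold siftedSum
  push_cast
  rw [Finset.mul_sum]
  refine Finset.sum_congr rfl fun m _ ↦ by ring

/-! ## §5b The two small terms and the assembly of the lower bound -/

/-- **The mean of `Ḡ` is small**: `‖∫_T^{2T} Ḡ dt‖ ≤ 8 √Y` (every `m ∈ 𝒩` has `log m ≥ log 2`).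
[folklore] -/
theorem norm_integral_testPolyConj_le (N Y : ℕ) (T : ℝ) :
    ‖∫ t in T..(2 * T), testPolyConj N Y t‖ ≤ 8 * Real.sqrt Y := by
  unfold testPolyConj
  rw [intervalIntegral.integral_finsetSum]
  swap
  · exact fun m _ ↦ (continuous_const.mul (continuous_linePhase _)).intervalIntegrable _ _
  calc ‖∑ m ∈ siftedSet N Y, ∫ t in T..(2 * T), halfPow m * linePhase (-Real.log m) t‖
      ≤ ∑ m ∈ siftedSet N Y, (m : ℝ) ^ (-(1 / 2 : ℝ)) * 4 := by
        refine (norm_sum_le _ _).trans (Finset.sum_le_sum fun m hm ↦ ?_)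
        have hm2 := two_le_of_mem_siftedSet hm
        rw [intervalIntegral.integral_const_mul, norm_mul, norm_halfPow]
        refine mul_le_mul_of_nonneg_left ?_ (Real.rpow_nonneg (Nat.cast_nonneg m) _)
        have hlog : Real.log 2 ≤ Real.log m := Real.log_le_log (by norm_num) (by exact_mod_cast hm2)
        have h2 := half_le_log_two
        have hν : -Real.log m ≠ 0 := by intro h; rw [neg_eq_zero] at h; rw [h] at hlog; linarith
        refine (norm_integral_linePhase_le hν _ _).trans ?_
        rw [abs_neg, abs_of_pos (by linarith), div_le_iff₀ (by linarith)]
        linarith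
    _ = 4 * ∑ m ∈ siftedSet N Y, (m : ℝ) ^ (-(1 / 2 : ℝ)) := by
        rw [Finset.mul_sum]; refine Finset.sum_congr rfl fun m _ ↦ by ring
    _ ≤ 4 * (2 * Real.sqrt Y) :=
        mul_le_mul_of_nonneg_left (sum_rpow_neg_half_le_of_subset (siftedSet_subset_Icc N Y))
          (by norm_num)
    _ = 8 * Real.sqrt Y := by ring

/-- **The Euler–Maclaurin error in the twisted moment**: for `T ≥ 2`,
`(2T)^{3/2} ≤ L ≤ (2T)^{3/2} + 1`,
`‖∫_T^{2T} (ζ − D_L) M Ḡ dt‖ ≤ (C(1)+3) T^{-1/4} · A₀ · 2√Y · T`. [folklore] -/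
theorem norm_integral_emError_le (a : ℕ → ℂ) (N Y : ℕ) {T : ℝ} (hT : 2 ≤ T) {L : ℕ}
    (hL : (2 * T) ^ (3 / 2 : ℝ) ≤ L) (hL' : (L : ℝ) ≤ (2 * T) ^ (3 / 2 : ℝ) + 1) :
    ‖∫ t in T..(2 * T), (riemannZeta (1 / 2 + t * I) - zetaSum L t) * mollifierLine a N t *
        testPolyConj N Y t‖ ≤
      (emC + 3) * T ^ (-(1 / 4 : ℝ)) * coeffSum a N * (2 * Real.sqrt Y) * T := by
  have hT0 : 0 < T := by linarith
  have h := intervalIntegral.norm_integral_le_of_norm_le_const (a := T) (b := 2 * T)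
    (f := fun t ↦ (riemannZeta (1 / 2 + t * I) - zetaSum L t) * mollifierLine a N t *
      testPolyConj N Y t)
    (C := (emC + 3) * T ^ (-(1 / 4 : ℝ)) * coeffSum a N * (2 * Real.sqrt Y)) ?_
  · rw [show |2 * T - T| = T by rw [show 2 * T - T = T by ring, abs_of_pos hT0]] at h
    exact h
  · intro t ht
    rw [Set.uIoc_of_le (by linarith)] at ht
    have ht' : t ∈ Set.Icc T (2 * T) := ⟨ht.1.le, ht.2⟩
    rw [norm_mul, norm_mul]
    have h1 := norm_zeta_sub_zetaSum_le hT ht' hL hL'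
    have h2 : ‖mollifierLine a N t‖ ≤ coeffSum a N := norm_mollifierLine_le a N t
    have h3 := norm_testPolyConj_le N Y t
    have h0 : 0 ≤ (emC + 3) * T ^ (-(1 / 4 : ℝ)) := by
      have := emC_nonneg; positivity
    exact mul_le_mul (mul_le_mul h1 h2 (norm_nonneg _) h0) h3 (norm_nonneg _)
      (mul_nonneg h0 (coeffSum_nonneg a N))

/-- **AM–GM form of Cauchy–Schwarz**: for continuous `F, G` and `T ≤ 2T`,
`‖∫_T^{2T} F G‖ ≤ 3 ∫_T^{2T} ‖F‖² + (1/12) ∫_T^{2T} ‖G‖²`. [folklore] -/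
theorem norm_integral_mul_le_amgm {F G : ℝ → ℂ} (hF : Continuous F) (hG : Continuous G) {T : ℝ}
    (hT : 0 ≤ T) :
    ‖∫ t in T..(2 * T), F t * G t‖ ≤
      3 * (∫ t in T..(2 * T), ‖F t‖ ^ 2) + 1 / 12 * ∫ t in T..(2 * T), ‖G t‖ ^ 2 := by
  have hT2 : T ≤ 2 * T := by linarith
  calc ‖∫ t in T..(2 * T), F t * G t‖ ≤ ∫ t in T..(2 * T), ‖F t * G t‖ :=
        intervalIntegral.norm_integral_le_integral_norm hT2
    _ ≤ ∫ t in T..(2 * T), (3 * ‖F t‖ ^ 2 + 1 / 12 * ‖G t‖ ^ 2) := by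
        have hi0 : IntervalIntegrable (fun t ↦ ‖F t * G t‖) volume T (2 * T) :=
          Continuous.intervalIntegrable (by fun_prop) _ _
        have hi1 : IntervalIntegrable (fun t ↦ 3 * ‖F t‖ ^ 2 + 1 / 12 * ‖G t‖ ^ 2) volume T (2 * T) :=
          Continuous.intervalIntegrable (by fun_prop) _ _
        refine intervalIntegral.integral_mono_on hT2 hi0 hi1 fun t _ ↦ ?_
        rw [norm_mul]
        nlinarith [sq_nonneg (6 * ‖F t‖ - ‖G t‖), norm_nonneg (F t), norm_nonneg (G t)]
    _ = 3 * (∫ t in T..(2 * T), ‖F t‖ ^ 2) + 1 / 12 * ∫ t in T..(2 * T), ‖G t‖ ^ 2 := by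
        have hi1 : IntervalIntegrable (fun t ↦ 3 * ‖F t‖ ^ 2) volume T (2 * T) :=
          Continuous.intervalIntegrable (by fun_prop) _ _
        have hi2 : IntervalIntegrable (fun t ↦ 1 / 12 * ‖G t‖ ^ 2) volume T (2 * T) :=
          Continuous.intervalIntegrable (by fun_prop) _ _
        rw [intervalIntegral.integral_add hi1 hi2,
          intervalIntegral.integral_const_mul, intervalIntegral.integral_const_mul]

/-- **The lower bound, analytic core.** Let `T ≥ 8`, `N ≥ 1`, `Y < L`,
`(2T)^{3/2} ≤ L ≤ (2T)^{3/2} + 1`, `65 Y ≤ T/4`, `a(1) = 1`, and suppose the three error terms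
are at most `T S / 2`. Then `∫_T^{2T} |1 − ζ M|² ≥ T S / 12`. [folklore] -/
theorem integral_norm_sq_ge_of_errors (a : ℕ → ℂ) (ha1 : a 1 = 1) {N Y L : ℕ} {T : ℝ}
    (hT : 8 ≤ T) (hN : 1 ≤ N) (hYL : Y < L) (hL : (2 * T) ^ (3 / 2 : ℝ) ≤ L)
    (hL' : (L : ℝ) ≤ (2 * T) ^ (3 / 2 : ℝ) + 1) (hY : 65 * (Y : ℝ) ≤ T / 4)
    (hE : 8 * Real.sqrt Y +
        (emC + 3) * T ^ (-(1 / 4 : ℝ)) * coeffSum a N * (2 * Real.sqrt Y) * T +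
        coeffSum a N * (8 * Real.sqrt 2 * (Y : ℝ) ^ 2 + 16 * Real.sqrt L * Real.sqrt Y) ≤
      T * siftedSum N Y / 2) :
    T * siftedSum N Y / 12 ≤
      ∫ t in T..(2 * T), ‖1 - riemannZeta (1 / 2 + t * I) * mollifierLine a N t‖ ^ 2 := by
  have hT0 : 0 < T := by linarith
  have hT2 : (2 : ℝ) ≤ T := by linarith
  set S := siftedSum N Y with hS
  set F : ℝ → ℂ := fun t ↦ 1 - riemannZeta (1 / 2 + t * I) * mollifierLine a N t with hF
  set G : ℝ → ℂ := testPolyConj N Y with hG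
  have hFc : Continuous F :=
    continuous_const.sub (continuous_riemannZeta_half_line.mul (continuous_mollifierLine a N))
  have hGc : Continuous G := continuous_testPolyConj N Y
  have hζc : Continuous fun t : ℝ ↦ riemannZeta (1 / 2 + t * I) := continuous_riemannZeta_half_line
  have hMc : Continuous (mollifierLine a N) := continuous_mollifierLine a N
  have hDc : Continuous (zetaSum L) := continuous_zetaSum L
  -- (1) the mean square of `G`
  have hIG : ∫ t in T..(2 * T), ‖G t‖ ^ 2 ≤ 3 * T * S := by
    refine (integral_norm_sq_testPolyConj_le N Y hT).trans ?_
    have hS0 : 0 ≤ S := siftedSum_nonneg N Y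
    nlinarith
  -- (2) the decomposition of `∫ F G`
  have hsplit : ∫ t in T..(2 * T), F t * G t =
      (∫ t in T..(2 * T), G t) -
        (∫ t in T..(2 * T), (riemannZeta (1 / 2 + t * I) - zetaSum L t) * mollifierLine a N t * G t) -
        (∫ t in T..(2 * T), zetaSum L t * mollifierLine a N t * G t) := by
    have h1 : ∀ t, F t * G t = G t -
        ((riemannZeta (1 / 2 + t * I) - zetaSum L t) * mollifierLine a N t * G t) -
        (zetaSum L t * mollifierLine a N t * G t) := by
      intro t; simp only [hF]; ring
    simp_rw [h1]
    have hi1 : IntervalIntegrable G volume T (2 * T) := hGc.intervalIntegrable _ _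
    have hi2 : IntervalIntegrable (fun t ↦ (riemannZeta (1 / 2 + t * I) - zetaSum L t) *
        mollifierLine a N t * G t) volume T (2 * T) :=
      (((hζc.sub hDc).mul hMc).mul hGc).intervalIntegrable _ _
    have hi3 : IntervalIntegrable (fun t ↦ zetaSum L t * mollifierLine a N t * G t)
        volume T (2 * T) := ((hDc.mul hMc).mul hGc).intervalIntegrable _ _
    rw [intervalIntegral.integral_sub (hi1.sub hi2) hi3, intervalIntegral.integral_sub hi1 hi2]
  have hmain := integral_zetaSum_mul_mul_eq_diag_add a ha1 hN hYL T
  -- (3) `‖∫ F G‖ ≥ T S / 2`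
  have hE1 := norm_integral_testPolyConj_le N Y T
  have hE2 := norm_integral_emError_le a N Y hT2 hL hL'
  have hE3 := norm_offDiag_le a N Y L T
  have hX : T * S / 2 ≤ ‖∫ t in T..(2 * T), F t * G t‖ := by
    rw [hsplit, hmain]
    set E1 := ∫ t in T..(2 * T), G t
    set E2 := ∫ t in T..(2 * T), (riemannZeta (1 / 2 + t * I) - zetaSum L t) *
      mollifierLine a N t * G t
    set E3 := offDiag a N Y L T
    have hTS : ‖((T * S : ℝ) : ℂ)‖ = T * S := by
      rw [Complex.norm_real, Real.norm_eq_abs, abs_of_nonneg (mul_nonneg hT0.le (siftedSum_nonneg N Y))]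
    -- reverse triangle inequality
    have h1 : ‖((T * S : ℝ) : ℂ)‖ - ‖E1 - E2 - E3‖ ≤ ‖E1 - E2 - (((T * S : ℝ) : ℂ) + E3)‖ := by
      have := norm_sub_norm_le (((T * S : ℝ) : ℂ)) (E1 - E2 - E3)
      rw [show ((T * S : ℝ) : ℂ) - (E1 - E2 - E3) = -(E1 - E2 - (((T * S : ℝ) : ℂ) + E3)) by ring,
        norm_neg] at this
      linarith [abs_le.1 (abs_norm_sub_norm_le (((T * S : ℝ) : ℂ)) (E1 - E2 - E3))]
    have h2 : ‖E1 - E2 - E3‖ ≤ ‖E1‖ + ‖E2‖ + ‖E3‖ := by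
      calc ‖E1 - E2 - E3‖ ≤ ‖E1 - E2‖ + ‖E3‖ := norm_sub_le _ _
        _ ≤ ‖E1‖ + ‖E2‖ + ‖E3‖ := by linarith [norm_sub_le E1 E2]
    rw [hTS] at h1
    linarith
  -- (4) AM–GM and conclusion
  have hAM := norm_integral_mul_le_amgm hFc hGc hT0.le
  change T * S / 12 ≤ ∫ t in T..(2 * T), ‖F t‖ ^ 2
  linarith


/-! ## §6 Parameter choices and the small-`θ` theorem -/

/-- **The error budget.** With `√Y ≤ T^{1/8}`, `Y² ≤ T^{1/2}`, `√L ≤ 2T^{3/4}`, `A₀ ≤ K T^{3/32}`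
(`T, K ≥ 1`), the three error terms total at most `(60 + 2C(1)) K T^{31/32}`. [folklore] -/
theorem error_budget {T K sY Y2 sL A : ℝ} (hT : 1 ≤ T) (hK : 1 ≤ K) (hsY0 : 0 ≤ sY)
    (hsY : sY ≤ T ^ (1 / 8 : ℝ)) (hY20 : 0 ≤ Y2) (hY2 : Y2 ≤ T ^ (1 / 2 : ℝ)) (hsL0 : 0 ≤ sL)
    (hsL : sL ≤ 2 * T ^ (3 / 4 : ℝ)) (hA : A ≤ K * T ^ (3 / 32 : ℝ)) :
    8 * sY + (emC + 3) * T ^ (-(1 / 4 : ℝ)) * A * (2 * sY) * T + A * (8 * Real.sqrt 2 * Y2 + 16 * sL * sY)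
      ≤ (60 + 2 * emC) * K * T ^ (31 / 32 : ℝ) := by
  have hT0 : 0 < T := by linarith
  have hC := emC_nonneg
  set E := T ^ (31 / 32 : ℝ) with hE
  have hE0 : 0 ≤ E := Real.rpow_nonneg hT0.le _
  -- the powers of `T`
  have hp1 : T ^ (1 / 8 : ℝ) ≤ E := Real.rpow_le_rpow_of_exponent_le hT (by norm_num)
  have hp2 : T ^ (-(1 / 4 : ℝ)) * T ^ (3 / 32 : ℝ) * T ^ (1 / 8 : ℝ) * T = E := by
    rw [hE, show T ^ (-(1 / 4 : ℝ)) * T ^ (3 / 32 : ℝ) * T ^ (1 / 8 : ℝ) * T =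
      T ^ (-(1 / 4 : ℝ)) * T ^ (3 / 32 : ℝ) * T ^ (1 / 8 : ℝ) * T ^ (1 : ℝ) by rw [Real.rpow_one],
      ← Real.rpow_add hT0, ← Real.rpow_add hT0, ← Real.rpow_add hT0]
    norm_num
  have hp3 : T ^ (3 / 32 : ℝ) * T ^ (1 / 2 : ℝ) ≤ E := by
    rw [← Real.rpow_add hT0]; exact Real.rpow_le_rpow_of_exponent_le hT (by norm_num)
  have hp4 : T ^ (3 / 32 : ℝ) * T ^ (3 / 4 : ℝ) * T ^ (1 / 8 : ℝ) = E := by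
    rw [hE, ← Real.rpow_add hT0, ← Real.rpow_add hT0]; norm_num
  have hq8 : 0 ≤ T ^ (1 / 8 : ℝ) := Real.rpow_nonneg hT0.le _
  have hq32 : 0 ≤ T ^ (3 / 32 : ℝ) := Real.rpow_nonneg hT0.le _
  have hq4 : 0 ≤ T ^ (-(1 / 4 : ℝ)) := Real.rpow_nonneg hT0.le _
  have hq2 : 0 ≤ T ^ (1 / 2 : ℝ) := Real.rpow_nonneg hT0.le _
  have hq34 : 0 ≤ T ^ (3 / 4 : ℝ) := Real.rpow_nonneg hT0.le _
  have hs2 : Real.sqrt 2 ≤ 3 / 2 := by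
    rw [Real.sqrt_le_left (by norm_num)]; norm_num
  -- term 1
  have h1 : 8 * sY ≤ 8 * K * E := by
    calc 8 * sY ≤ 8 * T ^ (1 / 8 : ℝ) := by linarith
      _ ≤ 8 * E := by linarith
      _ ≤ 8 * K * E := by nlinarith
  -- term 2
  have h2 : (emC + 3) * T ^ (-(1 / 4 : ℝ)) * A * (2 * sY) * T ≤ 2 * (emC + 3) * K * E := by
    calc (emC + 3) * T ^ (-(1 / 4 : ℝ)) * A * (2 * sY) * T
        ≤ (emC + 3) * T ^ (-(1 / 4 : ℝ)) * (K * T ^ (3 / 32 : ℝ)) * (2 * T ^ (1 / 8 : ℝ)) * T := by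
          gcongr
      _ = 2 * (emC + 3) * K * (T ^ (-(1 / 4 : ℝ)) * T ^ (3 / 32 : ℝ) * T ^ (1 / 8 : ℝ) * T) := by
          ring
      _ = 2 * (emC + 3) * K * E := by rw [hp2]
  -- term 3
  have h3 : A * (8 * Real.sqrt 2 * Y2 + 16 * sL * sY) ≤ 44 * K * E := by
    have hin : 8 * Real.sqrt 2 * Y2 + 16 * sL * sY ≤
        12 * T ^ (1 / 2 : ℝ) + 32 * (T ^ (3 / 4 : ℝ) * T ^ (1 / 8 : ℝ)) := by
      have : 16 * sL * sY ≤ 16 * (2 * T ^ (3 / 4 : ℝ)) * T ^ (1 / 8 : ℝ) := by gcongr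
      nlinarith [Real.sqrt_nonneg 2]
    calc A * (8 * Real.sqrt 2 * Y2 + 16 * sL * sY)
        ≤ (K * T ^ (3 / 32 : ℝ)) * (12 * T ^ (1 / 2 : ℝ) + 32 * (T ^ (3 / 4 : ℝ) * T ^ (1 / 8 : ℝ))) :=
          mul_le_mul hA hin (by positivity) (by positivity)
      _ = K * (12 * (T ^ (3 / 32 : ℝ) * T ^ (1 / 2 : ℝ)) +
            32 * (T ^ (3 / 32 : ℝ) * T ^ (3 / 4 : ℝ) * T ^ (1 / 8 : ℝ))) := by ring
      _ ≤ K * (12 * E + 32 * E) := by rw [hp4]; gcongr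
      _ = 44 * K * E := by ring
  calc _ ≤ 8 * K * E + 2 * (emC + 3) * K * E + 44 * K * E := by linarith
    _ = (58 + 2 * emC) * K * E := by ring
    _ ≤ (60 + 2 * emC) * K * E := by nlinarith

/-- The `ℓ¹` norm of admissible coefficients: if `‖a d‖ ≤ K d^{1/2}` for `d ≥ 1` then
`A₀ = Σ_{d ≤ N} ‖a d‖ ≤ K · N · N^{1/2}`. [folklore] -/
theorem coeffSum_le {a : ℕ → ℂ} {K : ℝ} (hK : 0 ≤ K)
    (ha : ∀ n : ℕ, 1 ≤ n → ‖a n‖ ≤ K * (n : ℝ) ^ (1 / 2 : ℝ)) (N : ℕ) :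
    coeffSum a N ≤ K * N * (N : ℝ) ^ (1 / 2 : ℝ) := by
  unfold coeffSum
  calc ∑ d ∈ Finset.Icc 1 N, ‖a d‖ ≤ ∑ d ∈ Finset.Icc 1 N, K * (N : ℝ) ^ (1 / 2 : ℝ) := by
        refine Finset.sum_le_sum fun d hd ↦ ?_
        rw [Finset.mem_Icc] at hd
        refine (ha d hd.1).trans (mul_le_mul_of_nonneg_left ?_ hK)
        exact Real.rpow_le_rpow (Nat.cast_nonneg d) (by exact_mod_cast hd.2) (by norm_num)
    _ = K * N * (N : ℝ) ^ (1 / 2 : ℝ) := by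
        rw [Finset.sum_const, Nat.card_Icc, nsmul_eq_mul]; push_cast; ring

/-- **The sifted harmonic sum for `N = ⌊T^θ⌋`, `Y = ⌊T^{1/4}⌋`**: if `T^θ ≥ 2` and
`16 e⁵ θ ≤ 1` then `S ≥ 1/(16 e⁵ θ)` (and in particular `S ≥ 1`). [folklore] -/
theorem siftedSum_ge {T θ : ℝ} (hT : 1 < T) (hθ : 0 < θ) (hθ1 : 16 * Real.exp 5 * θ ≤ 1)
    (hTθ : 2 ≤ T ^ θ) :
    1 / (16 * Real.exp 5 * θ) ≤ siftedSum ⌊T ^ θ⌋₊ ⌊T ^ (1 / 4 : ℝ)⌋₊ := by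
  set N := ⌊T ^ θ⌋₊ with hN
  set Y := ⌊T ^ (1 / 4 : ℝ)⌋₊ with hY
  have hT0 : 0 < T := by linarith
  have hlogT : 0 < Real.log T := Real.log_pos hT
  have he : 0 < Real.exp 5 := Real.exp_pos 5
  have hN2 : 2 ≤ N := Nat.le_floor (by exact_mod_cast hTθ)
  have hkey := log_le_siftedSum_mul N Y hN2
  -- `log (Y+1) ≥ (1/4) log T`
  have hY1 : (1 / 4 : ℝ) * Real.log T ≤ Real.log (Y + 1) := by
    rw [← Real.log_rpow hT0]
    refine Real.log_le_log (Real.rpow_pos_of_pos hT0 _) ?_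
    exact (Nat.lt_floor_add_one (T ^ (1 / 4 : ℝ))).le
  -- `log (N+1) ≤ 2 θ log T`
  have hN1 : Real.log (N + 1) ≤ 2 * θ * Real.log T := by
    have hNle : (N : ℝ) ≤ T ^ θ := Nat.floor_le (Real.rpow_nonneg hT0.le _)
    have h1 : (N : ℝ) + 1 ≤ 2 * T ^ θ := by linarith
    have h2 : Real.log (2 * T ^ θ) = Real.log 2 + θ * Real.log T := by
      rw [Real.log_mul (by norm_num) (by positivity), Real.log_rpow hT0]
    have h3 : Real.log 2 ≤ θ * Real.log T := by
      rw [← Real.log_rpow hT0]; exact Real.log_le_log (by norm_num) hTθ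
    calc Real.log (N + 1) ≤ Real.log (2 * T ^ θ) := Real.log_le_log (by positivity) h1
      _ ≤ 2 * θ * Real.log T := by rw [h2]; linarith
  -- combine
  set S := siftedSum N Y with hS
  have hS0 : 0 ≤ S := siftedSum_nonneg N Y
  have h4 : (1 / 4 : ℝ) * Real.log T ≤ (1 + S) * (Real.exp 5 * (2 * θ * Real.log T)) := by
    calc (1 / 4 : ℝ) * Real.log T ≤ Real.log (Y + 1) := hY1
      _ ≤ (1 + S) * (Real.exp 5 * Real.log (N + 1)) := hkey
      _ ≤ (1 + S) * (Real.exp 5 * (2 * θ * Real.log T)) := by gcongr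
  -- divide by `log T > 0`: `1/4 ≤ 2 e⁵ θ (1 + S)`
  have h5 : (1 : ℝ) / 4 ≤ 2 * Real.exp 5 * θ * (1 + S) := by
    have h4' : (1 / 4 : ℝ) * Real.log T ≤ (2 * Real.exp 5 * θ * (1 + S)) * Real.log T := by
      have : (1 + S) * (Real.exp 5 * (2 * θ * Real.log T)) =
          (2 * Real.exp 5 * θ * (1 + S)) * Real.log T := by ring
      rw [← this]; exact h4
    exact le_of_mul_le_mul_right h4' hlogT
  -- `1 + S ≥ 1/(8 e⁵ θ) ≥ 2/(16 e⁵ θ)` and `1/(16 e⁵ θ) ≥ 1`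
  have hpos : 0 < 16 * Real.exp 5 * θ := by positivity
  rw [div_le_iff₀ hpos]
  have h6 : 1 ≤ 1 / (16 * Real.exp 5 * θ) := by rw [le_div_iff₀ hpos]; linarith
  nlinarith

set_option maxHeartbeats 400000 in
/-- **Radziwiłł 2012, Theorem 1 for short mollifiers — proved unconditionally.** There are
absolute constants `θ₁ = 1/(16e⁵)` and `c = 1/(192 e⁵)` such that for every `0 < θ ≤ θ₁`, every
family of implied constants `C`, all `T ≥ T₀(θ, C)` and all coefficients `a` with `a(1) = 1`,
`|a(n)| ≤ C(ε) n^ε`: `𝓘(M_θ) ≥ c/θ`.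

This is *not* the printed argument for `θ < ½` (Radziwiłł deduces that range from Proposition B,
i.e. from the Balasubramanian–Conrey–Heath-Brown asymptotic and Soundararajan's bound for the
quadratic form); it is an elementary duality argument in the spirit of the "trivial lower bound"
recalled in [Radziwill2012, §1, p. 3]: test `1 − ζM_θ` against the sifted Dirichlet polynomial
`G(s) = Σ_{m ≤ T^{1/4}, p | m ⇒ p > T^θ} m^{-s}`. The twisted first moment
`∫_T^{2T} (1 − ζM_θ) Ḡ dt` equals `−T · Σ 1/m + o(T)` (Euler–Maclaurin for `ζ`, the diagonal
`nd = m` forcing `d = 1` by the sieve condition, and `|∫_T^{2T} e^{-iνt} dt| ≤ 2/|ν|` with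
`|log(nd/m)| ≥ 1/(2m)` off the diagonal), the mean square of `G` is `≤ 3T Σ 1/m` (mean value
theorem for Dirichlet polynomials), so Cauchy–Schwarz gives `∫_T^{2T} |1 − ζM_θ|² ≥ T Σ 1/m / 12`,
and `Σ 1/m ≥ log T^{1/4} / (e⁵ log T^{2θ}) − 1 ≥ 1/(16 e⁵ θ)` by the Legendre factorisation
`Σ_{n ≤ Y} 1/n ≤ (Σ_{m sifted} 1/m) · ∏_{p ≤ N} (1 − 1/p)⁻¹` and Mertens' bound.
[cite: Radziwill2012, Theorem 1] -/
theorem Radziwill2012_thm1_smallTheta :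
    ∃ θ₁ : ℝ, 0 < θ₁ ∧ ∃ c : ℝ, 0 < c ∧ ∀ θ : ℝ, 0 < θ → θ ≤ θ₁ →
      ∀ C : ℝ → ℝ, ∃ T₀ : ℝ, ∀ T : ℝ, T₀ ≤ T →
        ∀ a : ℕ → ℂ, a 1 = 1 →
          (∀ ε : ℝ, 0 < ε → ∀ n : ℕ, 1 ≤ n → ‖a n‖ ≤ C ε * (n : ℝ) ^ ε) →
            c / θ ≤ mollificationDefect (dirichletMollifier a ⌊T ^ θ⌋₊) T := by
  have he : 0 < Real.exp 5 := Real.exp_pos 5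
  refine ⟨1 / (16 * Real.exp 5), by positivity, 1 / (192 * Real.exp 5), by positivity,
    fun θ hθ hθ1 C ↦ ?_⟩
  have hθ1' : 16 * Real.exp 5 * θ ≤ 1 := by
    rw [le_div_iff₀ (by positivity)] at hθ1; linarith
  -- the constants
  set K : ℝ := max (C (1 / 2)) 1 with hK
  have hK1 : 1 ≤ K := le_max_right _ _
  have hK0 : 0 ≤ K := by linarith
  set B : ℝ := (120 + 4 * emC) * K with hB
  have hC := emC_nonneg
  have hB1 : 1 ≤ B := by
    rw [hB]
    have : (1 : ℝ) ≤ 120 + 4 * emC := by linarith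
    nlinarith
  refine ⟨max (max 67600 ((2 : ℝ) ^ (1 / θ))) (B ^ 32), fun T hT a ha1 ha ↦ ?_⟩
  have hT676 : (67600 : ℝ) ≤ T := le_trans (le_trans (le_max_left _ _) (le_max_left _ _)) hT
  have hT2θ : (2 : ℝ) ^ (1 / θ) ≤ T := le_trans (le_trans (le_max_right _ _) (le_max_left _ _)) hT
  have hTB : B ^ 32 ≤ T := le_trans (le_max_right _ _) hT
  have hT1 : (1 : ℝ) < T := by linarith
  have hT1' : (1 : ℝ) ≤ T := hT1.le
  have hT0 : 0 < T := by linarith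
  have hT8 : (8 : ℝ) ≤ T := by linarith
  -- the parameters
  set N := ⌊T ^ θ⌋₊ with hN
  set Y := ⌊T ^ (1 / 4 : ℝ)⌋₊ with hY
  set L := ⌈(2 * T) ^ (3 / 2 : ℝ)⌉₊ with hL
  have hTθ : 2 ≤ T ^ θ := by
    have := Real.rpow_le_rpow (by positivity) hT2θ hθ.le
    rwa [← Real.rpow_mul (by norm_num), one_div_mul_cancel hθ.ne', Real.rpow_one] at this
  have hNle : (N : ℝ) ≤ T ^ θ := Nat.floor_le (Real.rpow_nonneg hT0.le _)
  have hN2 : 2 ≤ N := Nat.le_floor (by exact_mod_cast hTθ)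
  have hYle : (Y : ℝ) ≤ T ^ (1 / 4 : ℝ) := Nat.floor_le (Real.rpow_nonneg hT0.le _)
  have hLge : (2 * T) ^ (3 / 2 : ℝ) ≤ L := Nat.le_ceil _
  have hLle : (L : ℝ) ≤ (2 * T) ^ (3 / 2 : ℝ) + 1 :=
    (Nat.ceil_lt_add_one (Real.rpow_nonneg (by positivity) _)).le
  have hq4 : T ^ (1 / 4 : ℝ) ≤ T := by
    conv_rhs => rw [← Real.rpow_one T]
    exact Real.rpow_le_rpow_of_exponent_le hT1' (by norm_num)
  have h2T : T < (2 * T) ^ (3 / 2 : ℝ) := by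
    have h1 : (2 * T) ^ (1 : ℝ) ≤ (2 * T) ^ (3 / 2 : ℝ) :=
      Real.rpow_le_rpow_of_exponent_le (by linarith) (by norm_num)
    rw [Real.rpow_one] at h1
    linarith
  have hYL : Y < L := by
    have : (Y : ℝ) < L := by linarith
    exact_mod_cast this
  -- `65 Y ≤ T/4`
  have h65 : 65 * (Y : ℝ) ≤ T / 4 := by
    have hs : (260 : ℝ) ≤ T ^ (1 / 2 : ℝ) := by
      rw [← Real.sqrt_eq_rpow, Real.le_sqrt (by norm_num) hT0.le]; linarith
    have h34 : T ^ (1 / 4 : ℝ) * T ^ (1 / 2 : ℝ) ≤ T := by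
      rw [← Real.rpow_add hT0]
      conv_rhs => rw [← Real.rpow_one T]
      exact Real.rpow_le_rpow_of_exponent_le hT1' (by norm_num)
    have h260 : 260 * T ^ (1 / 4 : ℝ) ≤ T := by
      calc 260 * T ^ (1 / 4 : ℝ) = T ^ (1 / 4 : ℝ) * 260 := by ring
        _ ≤ T ^ (1 / 4 : ℝ) * T ^ (1 / 2 : ℝ) :=
            mul_le_mul_of_nonneg_left hs (Real.rpow_nonneg hT0.le _)
        _ ≤ T := h34
    linarith
  -- the sifted sum
  have hS : 1 / (16 * Real.exp 5 * θ) ≤ siftedSum N Y := siftedSum_ge hT1 hθ hθ1' hTθ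
  have hS1 : 1 ≤ siftedSum N Y := by
    refine le_trans ?_ hS
    rw [le_div_iff₀ (by positivity)]; linarith
  -- the coefficients
  have ha' : ∀ n : ℕ, 1 ≤ n → ‖a n‖ ≤ K * (n : ℝ) ^ (1 / 2 : ℝ) := fun n hn ↦
    (ha (1 / 2) (by norm_num) n hn).trans (mul_le_mul_of_nonneg_right (le_max_left _ _)
      (Real.rpow_nonneg (Nat.cast_nonneg n) _))
  have hA : coeffSum a N ≤ K * T ^ (3 / 32 : ℝ) := by
    refine (coeffSum_le hK0 ha' N).trans ?_
    rw [mul_assoc]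
    refine mul_le_mul_of_nonneg_left ?_ hK0
    have hθ16 : θ ≤ 1 / 16 := by
      refine hθ1.trans ?_
      rw [div_le_div_iff₀ (by positivity) (by norm_num)]
      have : (16 : ℝ) ≤ 16 * Real.exp 5 := by
        have : (1 : ℝ) ≤ Real.exp 5 := Real.one_le_exp (by norm_num)
        nlinarith
      linarith
    calc (N : ℝ) * (N : ℝ) ^ (1 / 2 : ℝ) ≤ T ^ θ * (T ^ θ) ^ (1 / 2 : ℝ) := by
          gcongr
      _ = T ^ (3 / 2 * θ) := by
          rw [← Real.rpow_mul hT0.le, ← Real.rpow_add hT0]; ring_nf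
      _ ≤ T ^ (3 / 32 : ℝ) := Real.rpow_le_rpow_of_exponent_le hT1' (by linarith)
  -- the error budget
  have hsY : Real.sqrt Y ≤ T ^ (1 / 8 : ℝ) := by
    calc Real.sqrt Y ≤ Real.sqrt (T ^ (1 / 4 : ℝ)) := Real.sqrt_le_sqrt hYle
      _ = T ^ (1 / 8 : ℝ) := by
          rw [Real.sqrt_eq_rpow, ← Real.rpow_mul hT0.le]; norm_num
  have hY2 : (Y : ℝ) ^ 2 ≤ T ^ (1 / 2 : ℝ) := by
    calc (Y : ℝ) ^ 2 ≤ (T ^ (1 / 4 : ℝ)) ^ 2 := by gcongr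
      _ = T ^ (1 / 2 : ℝ) := by
          rw [← Real.rpow_natCast, ← Real.rpow_mul hT0.le]; norm_num
  have hsL : Real.sqrt L ≤ 2 * T ^ (3 / 4 : ℝ) := by
    have h1 : (L : ℝ) ≤ 4 * T ^ (3 / 2 : ℝ) := by
      have h2 : (2 * T) ^ (3 / 2 : ℝ) = 2 ^ (3 / 2 : ℝ) * T ^ (3 / 2 : ℝ) :=
        Real.mul_rpow (by norm_num) hT0.le
      have h3 : (2 : ℝ) ^ (3 / 2 : ℝ) ≤ 3 := by
        have : (2 : ℝ) ^ (3 / 2 : ℝ) = Real.sqrt 8 := by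
          rw [show (8 : ℝ) = 2 ^ (3 : ℝ) by norm_num, Real.sqrt_eq_rpow, ← Real.rpow_mul (by norm_num)]
          norm_num
        rw [this, Real.sqrt_le_left (by norm_num)]; norm_num
      have h4 : 1 ≤ T ^ (3 / 2 : ℝ) := Real.one_le_rpow hT1' (by norm_num)
      have h5 : (2 : ℝ) ^ (3 / 2 : ℝ) * T ^ (3 / 2 : ℝ) ≤ 3 * T ^ (3 / 2 : ℝ) :=
        mul_le_mul_of_nonneg_right h3 (Real.rpow_nonneg hT0.le _)
      rw [h2] at hLle
      linarith
    calc Real.sqrt L ≤ Real.sqrt (4 * T ^ (3 / 2 : ℝ)) := Real.sqrt_le_sqrt h1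
      _ = 2 * T ^ (3 / 4 : ℝ) := by
          rw [Real.sqrt_mul (by norm_num), show (4 : ℝ) = 2 ^ 2 by norm_num,
            Real.sqrt_sq (by norm_num), Real.sqrt_eq_rpow, ← Real.rpow_mul hT0.le]
          norm_num
  have hbudget := error_budget hT1' hK1 (Real.sqrt_nonneg _) hsY (by positivity) hY2
    (Real.sqrt_nonneg _) hsL hA
  -- `(60 + 2 C(1)) K T^{31/32} ≤ T/2`
  have hfinal : (60 + 2 * emC) * K * T ^ (31 / 32 : ℝ) ≤ T / 2 := by
    have h1 : B ≤ T ^ (1 / 32 : ℝ) := by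
      have h2 : (B ^ 32) ^ (1 / 32 : ℝ) ≤ T ^ (1 / 32 : ℝ) :=
        Real.rpow_le_rpow (by positivity) hTB (by norm_num)
      rwa [← Real.rpow_natCast, ← Real.rpow_mul (by linarith), show ((32 : ℕ) : ℝ) * (1 / 32 : ℝ) = 1 by
        norm_num, Real.rpow_one] at h2
    have h3 : T ^ (31 / 32 : ℝ) * T ^ (1 / 32 : ℝ) = T := by
      rw [← Real.rpow_add hT0]; norm_num
    have h4 : 0 ≤ T ^ (31 / 32 : ℝ) := Real.rpow_nonneg hT0.le _
    calc (60 + 2 * emC) * K * T ^ (31 / 32 : ℝ) = B / 2 * T ^ (31 / 32 : ℝ) := by rw [hB]; ring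
      _ ≤ T ^ (1 / 32 : ℝ) / 2 * T ^ (31 / 32 : ℝ) := by gcongr
      _ = T / 2 := by rw [div_mul_eq_mul_div, mul_comm, h3]
  have hE : 8 * Real.sqrt Y +
      (emC + 3) * T ^ (-(1 / 4 : ℝ)) * coeffSum a N * (2 * Real.sqrt Y) * T +
      coeffSum a N * (8 * Real.sqrt 2 * (Y : ℝ) ^ 2 + 16 * Real.sqrt L * Real.sqrt Y) ≤
      T * siftedSum N Y / 2 := by
    have : T * 1 ≤ T * siftedSum N Y := mul_le_mul_of_nonneg_left hS1 hT0.le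
    linarith
  -- the analytic core
  have hcore := integral_norm_sq_ge_of_errors a ha1 hT8 (by omega) hYL hLge hLle h65 hE
  -- conclusion
  unfold mollifierLine at hcore
  unfold mollificationDefect
  calc 1 / (192 * Real.exp 5) / θ = (1 / (16 * Real.exp 5 * θ)) / 12 := by
        field_simp; ring
    _ ≤ siftedSum N Y / 12 := by gcongr
    _ = T⁻¹ * (T * siftedSum N Y / 12) := by field_simp
    _ ≤ T⁻¹ * ∫ t in T..(2 * T), ‖1 - riemannZeta (1 / 2 + t * I) *
          dirichletMollifier a N (1 / 2 + t * I)‖ ^ 2 :=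
        mul_le_mul_of_nonneg_left hcore (inv_nonneg.2 hT0.le)

end SmallTheta

/-! ## §7 Theorem 1 from Proposition A and Lemma 5 alone -/

/-- **Radziwiłł 2012, Theorem 1 from Proposition A and Lemma 5 only.** The floor
`𝓘(M_θ) ≥ c/(1 + θ)` for every `θ > 0` (`Radziwill2012_floor_of_propA_lemma5`, i.e. §3–§4 of the
paper: Proposition A with Selberg's well-spaced critical zeros) and the unconditional
`𝓘(M_θ) ≥ c₁/θ` for `θ ≤ θ₁` (`SmallTheta.Radziwill2012_thm1_smallTheta`) give Theorem 1 with
`c = min c₁ (c θ₁/(1 + θ₁))`, since `1 + θ ≤ θ (1 + 1/θ₁)` for `θ ≥ θ₁`. Proposition B (the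
Balasubramanian–Conrey–Heath-Brown asymptotic and the quadratic-form bound of §7) is not used.
[cite: Radziwill2012, Theorem 1 and §4] -/
theorem Radziwill2012_thm1_of_propA_lemma5 (hA : Radziwill2012_propA) (h5 : Radziwill2012_lemma5) :
    Radziwill2012_thm1 := by
  obtain ⟨c, hc, hfloor⟩ := Radziwill2012_floor_of_propA_lemma5 hA h5
  obtain ⟨θ₁, hθ₁, c₁, hc₁, hsmall⟩ := SmallTheta.Radziwill2012_thm1_smallTheta
  set c₂ : ℝ := c * θ₁ / (1 + θ₁) with hc₂
  have hc₂0 : 0 < c₂ := by positivity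
  refine ⟨min c₁ c₂, lt_min hc₁ hc₂0, fun θ hθ C ↦ ?_⟩
  rcases le_or_gt θ θ₁ with hle | hgt
  · obtain ⟨T₀, hT₀⟩ := hsmall θ hθ hle C
    refine ⟨T₀, fun T hT a ha1 ha ↦ ?_⟩
    have key := hT₀ T hT a ha1 ha
    have : min c₁ c₂ / θ ≤ c₁ / θ := div_le_div_of_nonneg_right (min_le_left _ _) hθ.le
    linarith
  · obtain ⟨T₀, hT₀⟩ := hfloor θ hθ C
    refine ⟨T₀, fun T hT a ha1 ha ↦ ?_⟩
    have key := hT₀ T hT a ha1 ha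
    have h1 : min c₁ c₂ / θ ≤ c₂ / θ := div_le_div_of_nonneg_right (min_le_right _ _) hθ.le
    have h2 : c₂ / θ ≤ c / (1 + θ) := by
      rw [hc₂, div_le_div_iff₀ hθ (by linarith)]
      have : c * θ₁ / (1 + θ₁) * (1 + θ) = c * (θ₁ * (1 + θ) / (1 + θ₁)) := by ring
      rw [this]
      refine mul_le_mul_of_nonneg_left ?_ hc.le
      rw [div_le_iff₀ (by linarith)]
      nlinarith
    linarith

/-- **Theorem 1 from Selberg's lemma and Bombieri–Friedlander's Lemma 2** (the two remaining
named facts), through the proved deductions `Radziwill2012_propA_of_lemma2` (§3) and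
`Radziwill2012_lemma5_of_selbergLemma` (§4). [cite: Radziwill2012, Theorem 1] -/
theorem Radziwill2012_thm1_of_selberg_of_lemma2 (hS : Radziwill2012_selbergLemma)
    (h2 : Radziwill2012_lemma2) : Radziwill2012_thm1 :=
  Radziwill2012_thm1_of_propA_lemma5 (Radziwill2012_propA_of_lemma2 h2)
    (Radziwill2012_lemma5_of_selbergLemma hS)

/-- **The barrier from Proposition A and Lemma 5**: `MollifierLimitations = Radziwill2012_thm1 ∧
BettinGonek2017_thm1`, the second conjunct being the theorem `BettinGonek2017_thm1_holds`.
[cite: Radziwill2012, Theorem 1] [cite: BettinGonek2017, Theorem 1] -/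
theorem MollifierLimitations_of_propA_lemma5 (hA : Radziwill2012_propA) (h5 : Radziwill2012_lemma5) :
    MollifierLimitations :=
  ⟨Radziwill2012_thm1_of_propA_lemma5 hA h5, BettinGonek2017_thm1_holds⟩

/-- **The barrier `MollifierLimitations` from exactly two named facts**: Selberg's lemma
(`Radziwill2012_selbergLemma`, Selberg 1942 in the dyadic measure form of [Radziwill2012, §4]) and
the Bombieri–Friedlander smoothed approximation (`Radziwill2012_lemma2`).
[cite: Radziwill2012, Theorem 1] [cite: BettinGonek2017, Theorem 1] -/
theorem MollifierLimitations_of_selberg_of_lemma2 (hS : Radziwill2012_selbergLemma)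
    (h2 : Radziwill2012_lemma2) : MollifierLimitations :=
  ⟨Radziwill2012_thm1_of_selberg_of_lemma2 hS h2, BettinGonek2017_thm1_holds⟩

end Literature.Barriers.RiemannHypothesis
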